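import Mathlib.Analysis.InnerProductSpace.PiL2
import Mathlib.Analysis.SpecialFunctions.Trigonometric.Series
import Mathlib.Analysis.SpecialFunctions.Log.Base
import Mathlib.LinearAlgebra.Dimension.Constructions
import Mathlib.LinearAlgebra.FiniteDimensional.Lemmas
import Literature.Computability.QuantumComplexity.ApproxStabilizerRankTransfer
import Literature.Computability.QuantumComplexity.StabilizerSimulationProofs
import Literature.Computability.QuantumComplexity.LightConeAmp
import HarnessLib

/-!
# Typical states have large approximate stabilizer rank — discharge of
# `MehrabanTahmasbi2024_exists_large_approxRank` (Mehraban–Tahmasbi 2024, Lemma 3.2)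

Topic `Literature/Computability/QuantumComplexity`; second sibling proof file of
`ApproxStabilizerRankTransfer.lean` (the first, `ApproxStabilizerRankTransferProofs.lean`,
discharges Lemma 3.6; both are kept separate so that the statement file keeps its light imports).
It proves, sorry-free and over the tree's operational definitions (`stabilizerStates` = Clifford
orbit of `|0ⁿ⟩`, `stabilizerRank`, `approxStabilizerRank`, `normSq`), the named fact

* `MehrabanTahmasbi2024_exists_large_approxRank_holds` — S. Mehraban, M. Tahmasbi, *Quadratic lower
  bounds on the approximate stabilizer rank: a probabilistic approach*, STOC 2024 =
  arXiv:2305.10277, **Lemma 3.2** (second display, read at the source, §3.1 pp. 12–13): for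
  `0 < δ < 1` and `n ≥ 2 log₂(1/(1−δ²)) + 9` some unit `n`-qubit state `φ` has
  `χ_δ(φ) ≥ (1/1000) (1−δ²)² 2ⁿ/n²`.

## The printed proof and the road taken here

Printed (§3.1): draw `φ` from the Haar measure; `χ_δ(φ) ≤ M` forces `‖P_S φ‖² ≥ 1 − δ²` for the
projection `P_S` onto the span of some `M` stabilizer states (Lemma 3.4); union bound over the
`|Stab_n|^M ≤ e^{0.54 n² M}` choices of `S` (Lemma 2.2, the Aaronson–Gottesman count) and Lévy
concentration for the `2`-Lipschitz `φ ↦ ‖Pφ‖` with mean `≤ M/2ⁿ` (Theorem 2.3, Lemma 2.4) give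
`Pr[χ_δ(φ) ≤ M] ≤ 2 exp(0.54 n² M − (1 − δ² − M/2ⁿ)² 2ⁿ/(100π)) < 1` for `M = (1−δ²)² 2ⁿ/(1000 n²)`.

Neither the Haar measure on the unit sphere of `ℂ^{2ⁿ}`, nor Lévy's lemma, nor the stabilizer
formalism behind `|Stab_n| = 2ⁿ ∏ (2^k + 1)` exist in Mathlib or the tree, so the same architecture
(count the low-rank spans · bound the mass of states near one span · union bound) is run over a
**finite** probability space, with every ingredient proved here from scratch:

1. **Counting stabilizer directions** (`ApproxRankTypical.exists_param_of_mem_stabilizerStates`,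
   replacing Lemma 2.2): the Dehaene–De Moor normal form — every vector of the Clifford orbit of
   `|0ⁿ⟩` is `c · [x ∈ A] · i^{ℓ(x) + 2 q(x)}` with `A` an affine subspace of `𝔽₂ⁿ`, `ℓ` linear with
   values in `ℤ₄` and `q` quadratic over `𝔽₂` (Dehaene–De Moor 2003, Thm. 5; Van den Nest 2010,
   §3) — proved by closure of this family under the generators `S_j` (phase `+[x_j]`), `CNOT`
   (linear substitution) and `H_j` (the case analysis `repr_hGate`: an equation mentions `x_j`, or
   the flip difference of the phase is even/odd). Parametrising `A = a + span(v₁,…,v_n)` and the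
   phase by its `≤ n + n²` coefficients gives `2^{3n²+3n}` vectors `vec P` of which every
   stabilizer state is a scalar multiple; with the attained rank (`exists_stabilizerDecomposition`)
   every vector of stabilizer rank `≤ r` lies in one of `2^{(3n²+3n) r}` spans of `r` vectors.
2. **Mass near one span** over the `2^{2ⁿ}` *sign states* `φ_s = 2^{−n/2} Σ_x (−1)^{s(x)} |x⟩`
   (replacing Haar + Lévy): Hoeffding's exponential-moment bound
   `#{s : Σ ε_s(x) u_x ≥ T} ≤ 2^D e^{−T²/(2Σu²)}` (`card_signs_sum_ge_le`, via
   `cosh y ≤ e^{y²/2}`) shows that at most `2^D e^{−D(1−δ'²)/2}` sign states are within `δ'` of any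
   fixed vector (`card_signVec_close_le`, `D = 2ⁿ`); rounding the coordinates of the nearest point of
   the span in an orthonormal basis (`stdOrthonormalBasis`) to a grid of mesh `ε/(2r)` replaces the
   ε-net: sign states with equal roundings are within `δ' = δ + ε` of a common centre, whence
   `#{s : dist(φ_s, span) ≤ δ} ≤ (2⌈4r/ε⌉+3)^{2r} 2^D e^{−D(1−(δ+ε)²)/2}`
   (`card_signVec_close_span_le`).
3. **Union bound** (`key_inequality`, the assembly in the final theorem): with `ε = (1−δ²)/4`,
   `r = ⌈(1−δ²)² 2ⁿ/(1000 n²)⌉ − 1` and `n ≥ 2 log₂(1/(1−δ²)) + 9` the total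
   `2^{(3n²+3n)r} (2⌈16r/(1−δ²)⌉+3)^{2r} 2^D e^{−D(1−(δ+ε)²)/2}` is `< 2^D` (with room: the exponent is
   `≤ 2ⁿ(1−δ²)((1−δ²)/250 − 1/8) < 0`), so some sign state is `δ`-far from every vector of rank
   `≤ r` and has `χ_δ ≥ r + 1 ≥ (1/1000)(1−δ²)² 2ⁿ/n²`.

So the discharge is the printed statement with the printed constant `1/1000`; the witness is a
sign state rather than a Haar-typical state (the lemma only asserts existence).

## Main declarations (namespace `ApproxRankTypical`)

* `IsQF`, `IsAff2`, `AffEq`, `ddm`, `Repr`, `repr_sGate`, `repr_cnot`, `repr_hGate`,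
  `repr_of_mem_stabilizerStates` — the normal form; `Param`, `vec`, `card_param`,
  `exists_param_of_mem_stabilizerStates` — the count;
* `sgn`, `signVec`, `sum_exp_sgn_sum`, `card_signs_sum_ge_le`, `card_signVec_close_le` — Hoeffding;
* `card_signVec_close_span_le` — the grid net; `key_inequality`; and the discharge
  `MehrabanTahmasbi2024_exists_large_approxRank_holds` (root namespace of the topic).

## References

* S. Mehraban, M. Tahmasbi, *Quadratic lower bounds on the approximate stabilizer rank: a
  probabilistic approach*, STOC 2024, arXiv:2305.10277: Lemma 3.2 and its proof (§3.1), Lemma 3.4,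
  Lemma 2.2, Theorem 2.3, Lemma 2.4. [MehrabanTahmasbi2024]
* J. Dehaene, B. De Moor, *Clifford group, stabilizer states, and linear and quadratic operations
  over GF(2)*, Phys. Rev. A 68 (2003) 042318, Thm. 5 (amplitudes of stabilizer states).
* M. Van den Nest, *Classical simulation of quantum computation, the Gottesman–Knill theorem, and
  slightly beyond*, Quantum Inf. Comput. 10 (2010) 258–271, §3.
* S. Aaronson, D. Gottesman, *Improved simulation of stabilizer circuits*, PRA 70 (2004) 052328
  (count of stabilizer states).
* W. Hoeffding, *Probability inequalities for sums of bounded random variables*, JASA 58 (1963),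
  Thm. 2 (here in exponential-moment/counting form for Rademacher sums).

## Design notes

* Bits of a register label `x : Fin n → Bool` enter the algebra through `bz : Bool → ZMod 2` and
  `bq : Bool → ZMod 4`; all identities between `ZMod 2`, `ZMod 4` and `Bool` are `decide`d.
* Supports are carried as *lists* of affine equations during the closure proof (no Gaussian
  elimination is needed: in the `H` case an equation mentioning `x_j` is used to eliminate `x_j`);
  finiteness enters only at the end, through a spanning family of the solution space's direction
  (`Module.finBasis`).
* The probabilistic part is stated for an arbitrary finite index type `X` and specialised to
  `X = QReg n` in the assembly; decidability of the (noncomputable) predicates is classical.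
-/

noncomputable section

namespace Literature.Computability.QuantumComplexity

open _root_.Computability Cryptography Matrix Finset

namespace ApproxRankTypical

variable {n : ℕ}

/-! ### Bits in `ZMod 2` and `ZMod 4` -/

/-- A bit as an element of `𝔽₂`. [folklore] -/
def bz (b : Bool) : ZMod 2 := if b then 1 else 0

/-- A bit as an element of `ℤ₄` (the exponent of `i`). [folklore] -/
def bq (b : Bool) : ZMod 4 := if b then 1 else 0

/-- The lift `𝔽₂ → ℤ₄`, `0 ↦ 0`, `1 ↦ 1`. [folklore] -/
def lift (z : ZMod 2) : ZMod 4 := if z = 0 then 0 else 1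

/-- Reduction `ℤ₄ → 𝔽₂` (parity). [folklore] -/
def red (a : ZMod 4) : ZMod 2 := if a = 1 ∨ a = 3 then 1 else 0

/-- The high bit of an element of `ℤ₄`. [folklore] -/
def hi (a : ZMod 4) : Bool := decide (a = 2 ∨ a = 3)

/-- `𝔽₂ → Bool`. [folklore] -/
def toBool (z : ZMod 2) : Bool := decide (z ≠ 0)

/-- `bz true = 1`. [folklore] -/
@[simp] theorem bz_true : bz true = 1 := rfl
/-- `bz false = 0`. [folklore] -/
@[simp] theorem bz_false : bz false = 0 := rfl
/-- `bq true = 1`. [folklore] -/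
@[simp] theorem bq_true : bq true = 1 := rfl
/-- `bq false = 0`. [folklore] -/
@[simp] theorem bq_false : bq false = 0 := rfl

/-- The lift of a bit is the bit. [folklore] -/
theorem lift_bz (b : Bool) : lift (bz b) = bq b := by cases b <;> decide
/-- The parity of a bit is the bit. [folklore] -/
theorem red_bq (b : Bool) : red (bq b) = bz b := by cases b <;> decide
/-- `bz ∘ toBool = id`. [folklore] -/
theorem bz_toBool (z : ZMod 2) : bz (toBool z) = z := by revert z; decide
/-- `toBool ∘ bz = id`. [folklore] -/
theorem toBool_bz (b : Bool) : toBool (bz b) = b := by cases b <;> decide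
/-- The carry identity `[u + v] = [u] + [v] + 2[u][v]` in `ℤ₄`. [folklore] -/
theorem lift_add (u v : ZMod 2) : lift (u + v) = lift u + lift v + 2 * lift u * lift v := by
  revert u v; decide
/-- Lifting commutes with multiplication by a bit. [folklore] -/
theorem lift_mul_bz (a : ZMod 2) (b : Bool) : lift (a * bz b) = lift a * bq b := by
  revert a; cases b <;> decide
/-- Parity is additive. [folklore] -/
theorem red_add (a b : ZMod 4) : red (a + b) = red a + red b := by revert a b; decide
/-- Parity is multiplicative. [folklore] -/
theorem red_mul (a b : ZMod 4) : red (a * b) = red a * red b := by revert a b; decide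
/-- `red ∘ lift = id`. [folklore] -/
theorem red_lift (z : ZMod 2) : red (lift z) = z := by revert z; decide
/-- `2a` only depends on the parity of `a`. [folklore] -/
theorem two_mul_eq_two_mul_lift_red (a : ZMod 4) : 2 * a = 2 * lift (red a) := by revert a; decide
/-- Binary expansion in `ℤ₄`: `a = [a mod 2] + 2·[high bit]`. [folklore] -/
theorem eq_lift_red_add (a : ZMod 4) : a = lift (red a) + 2 * bq (hi a) := by revert a; decide
/-- A lift is `0` or `1`. [folklore] -/
theorem lift_eq_zero_or_one (z : ZMod 2) : lift z = 0 ∨ lift z = 1 := by revert z; decide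
/-- `xor` is addition in `𝔽₂`. [folklore] -/
theorem bz_xor (a b : Bool) : bz (a ^^ b) = bz a + bz b := by cases a <;> cases b <;> decide
/-- `and` is multiplication of the lifts. [folklore] -/
theorem bq_and (a b : Bool) : bq (a && b) = bq a * bq b := by cases a <;> cases b <;> decide
/-- Characteristic two. [folklore] -/
theorem zmod2_add_self (a : ZMod 2) : a + a = 0 := by revert a; decide
/-- A nonzero element of `𝔽₂` is `1`. [folklore] -/
theorem zmod2_eq_one_of_ne_zero {a : ZMod 2} (h : a ≠ 0) : a = 1 := by revert a; decide
/-- `4 = 0` in `ℤ₄`. [folklore] -/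
theorem four_eq_zero : (4 : ZMod 4) = 0 := by decide
/-- `bz b = 0 ↔ b = false`. [folklore] -/
theorem bz_eq_zero_iff (b : Bool) : bz b = 0 ↔ b = false := by cases b <;> decide
/-- `toBool z ↔ z = 1`. [folklore] -/
theorem toBool_eq_true_iff (z : ZMod 2) : toBool z = true ↔ z = 1 := by revert z; decide
/-- `red 0 = 0`. [folklore] -/
@[simp] theorem red_zero : red 0 = 0 := by decide

/-- Parity of a sum. [folklore] -/
theorem red_sum {ι : Type*} (s : Finset ι) (f : ι → ZMod 4) : red (∑ i ∈ s, f i) = ∑ i ∈ s, red (f i) := by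
  classical
  induction s using Finset.induction_on with
  | empty => simp
  | insert a s ha ih => rw [Finset.sum_insert ha, Finset.sum_insert ha, red_add, ih]

/-! ### `ℤ₄`-valued quadratic phase functions on `𝔽₂ⁿ` -/

/-- `p : 𝔽₂ⁿ → ℤ₄` is a *quadratic phase function*: `p(x) = c + Σ lᵢ [xᵢ] + 2 Σ q_{ik} [xᵢ][x_k]`
(Dehaene–De Moor 2003: the phases `i^{ℓ(x)} (−1)^{q(x)}` of stabilizer states). [folklore] -/
def IsQF (p : QReg n → ZMod 4) : Prop :=
  ∃ (c : ZMod 4) (l : Fin n → ZMod 4) (q : Fin n → Fin n → ZMod 4),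
    ∀ x, p x = c + ∑ i, l i * bq (x i) + 2 * ∑ i, ∑ k, q i k * (bq (x i) * bq (x k))

namespace IsQF

/-- `IsQF` is extensional. [folklore] -/
theorem congr {p p' : QReg n → ZMod 4} (h : IsQF p) (e : ∀ x, p x = p' x) : IsQF p' := by
  obtain ⟨c, l, q, hp⟩ := h
  exact ⟨c, l, q, fun x => (e x).symm.trans (hp x)⟩

/-- Constants are quadratic phase functions. [folklore] -/
theorem const (c : ZMod 4) : IsQF (fun _ : QReg n => c) :=
  ⟨c, 0, 0, fun _ => by simp⟩

/-- Coordinates `[x_i]` are quadratic phase functions. [folklore] -/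
theorem coord (i : Fin n) : IsQF (fun x : QReg n => bq (x i)) := by
  classical
  refine ⟨0, fun k => if k = i then 1 else 0, 0, fun _ => ?_⟩
  simp [ite_mul, Finset.sum_ite_eq']

/-- Sums of quadratic phase functions. [folklore] -/
theorem add {p p' : QReg n → ZMod 4} (h : IsQF p) (h' : IsQF p') : IsQF (fun x => p x + p' x) := by
  obtain ⟨c, l, q, hp⟩ := h
  obtain ⟨c', l', q', hp'⟩ := h'
  refine ⟨c + c', l + l', q + q', fun x => ?_⟩
  dsimp only
  rw [hp x, hp' x]
  simp only [Pi.add_apply, add_mul, Finset.sum_add_distrib, mul_add]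
  ring

/-- Constant multiples of quadratic phase functions. [folklore] -/
theorem smul (a : ZMod 4) {p : QReg n → ZMod 4} (h : IsQF p) : IsQF (fun x => a * p x) := by
  obtain ⟨c, l, q, hp⟩ := h
  refine ⟨a * c, fun i => a * l i, fun i k => a * q i k, fun x => ?_⟩
  dsimp only
  rw [hp x]
  simp only [mul_add, Finset.mul_sum]
  congr 1
  · congr 1
    exact Finset.sum_congr rfl fun i _ => by ring
  · exact Finset.sum_congr rfl fun i _ => Finset.sum_congr rfl fun k _ => by ring

/-- Finite sums of quadratic phase functions. [folklore] -/
theorem sum {ι : Type*} (s : Finset ι) (F : ι → QReg n → ZMod 4) (h : ∀ i ∈ s, IsQF (F i)) :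
    IsQF (fun x => ∑ i ∈ s, F i x) := by
  classical
  induction s using Finset.induction_on with
  | empty => simpa using const (n := n) 0
  | insert a s ha ih =>
    have := (h a (Finset.mem_insert_self a s)).add (ih fun i hi => h i (Finset.mem_insert_of_mem hi))
    refine this.congr fun x => ?_
    rw [Finset.sum_insert ha]

/-- `2 p p'` is a quadratic phase function for quadratic `p, p'` (the factor `2` kills the quartic
and cubic terms modulo `4`). [folklore] -/
theorem two_mul_mul {p p' : QReg n → ZMod 4} (h : IsQF p) (h' : IsQF p') :
    IsQF (fun x => 2 * p x * p' x) := by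
  obtain ⟨c, l, q, hp⟩ := h
  obtain ⟨c', l', q', hp'⟩ := h'
  refine ⟨2 * c * c', fun i => 2 * (c * l' i + c' * l i), fun i k => l i * l' k, fun x => ?_⟩
  dsimp only
  set L := ∑ i, l i * bq (x i) with hL
  set L' := ∑ i, l' i * bq (x i) with hL'
  set Q := ∑ i, ∑ k, q i k * (bq (x i) * bq (x k)) with hQ
  set Q' := ∑ i, ∑ k, q' i k * (bq (x i) * bq (x k)) with hQ'
  have e1 : 2 * p x * p' x = 2 * c * c' + 2 * (c * L' + c' * L) + 2 * (L * L') := by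
    rw [hp x, hp' x]
    linear_combination ((c + L) * Q' + Q * (c' + L' + 2 * Q')) * four_eq_zero
  have e2 : 2 * (c * L' + c' * L) = ∑ i, 2 * (c * l' i + c' * l i) * bq (x i) := by
    rw [hL, hL', Finset.mul_sum, Finset.mul_sum, ← Finset.sum_add_distrib, Finset.mul_sum]
    exact Finset.sum_congr rfl fun i _ => by ring
  have e3 : L * L' = ∑ i, ∑ k, l i * l' k * (bq (x i) * bq (x k)) := by
    rw [hL, hL', Finset.sum_mul_sum]
    exact Finset.sum_congr rfl fun i _ => Finset.sum_congr rfl fun k _ => by ring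
  rw [e1, e2, e3]

/-- The lift of an affine form over `𝔽₂` is a quadratic phase function:
`[b + Σ αᵢ xᵢ] = Σ [αᵢ xᵢ] + 2 e₂(…) (mod 4)` (the parity identity). [folklore] -/
theorem lift_affine (α : Fin n → ZMod 2) (b : ZMod 2) :
    IsQF (fun x : QReg n => lift (b + ∑ i, α i * bz (x i))) := by
  classical
  suffices h : ∀ s : Finset (Fin n),
      IsQF (fun x : QReg n => lift (b + ∑ i ∈ s, α i * bz (x i))) from h Finset.univ
  intro s
  induction s using Finset.induction_on with
  | empty => simpa using const (n := n) (lift b)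
  | insert a s ha ih =>
    have hc : IsQF (fun x : QReg n => lift (α a) * bq (x a)) := (coord a).smul (lift (α a))
    refine ((ih.add hc).add (ih.two_mul_mul hc)).congr fun x => ?_
    rw [Finset.sum_insert ha,
      show b + (α a * bz (x a) + ∑ i ∈ s, α i * bz (x i)) =
        (b + ∑ i ∈ s, α i * bz (x i)) + α a * bz (x a) by ring,
      lift_add (b + ∑ i ∈ s, α i * bz (x i)) (α a * bz (x a)), lift_mul_bz]

end IsQF

/-! ### Affine forms over `𝔽₂` -/

/-- `g : 𝔽₂ⁿ → 𝔽₂` is affine: `g(x) = b + Σ αᵢ xᵢ`. [folklore] -/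
def IsAff2 (g : QReg n → ZMod 2) : Prop :=
  ∃ (α : Fin n → ZMod 2) (b : ZMod 2), ∀ x, g x = b + ∑ i, α i * bz (x i)

/-- A Boolean function of the register is affine if its `𝔽₂`-value is. [folklore] -/
def IsAffB (f : QReg n → Bool) : Prop := IsAff2 (fun x => bz (f x))

namespace IsAff2

/-- `IsAff2` is extensional. [folklore] -/
theorem congr {g g' : QReg n → ZMod 2} (h : IsAff2 g) (e : ∀ x, g x = g' x) : IsAff2 g' := by
  obtain ⟨α, b, hg⟩ := h
  exact ⟨α, b, fun x => (e x).symm.trans (hg x)⟩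

/-- Constants are affine. [folklore] -/
theorem const (b : ZMod 2) : IsAff2 (fun _ : QReg n => b) := ⟨0, b, fun _ => by simp⟩

/-- Coordinates are affine. [folklore] -/
theorem coord (i : Fin n) : IsAff2 (fun x : QReg n => bz (x i)) := by
  classical
  refine ⟨fun k => if k = i then 1 else 0, 0, fun _ => ?_⟩
  simp [ite_mul, Finset.sum_ite_eq']

/-- Sums of affine forms. [folklore] -/
theorem add {g g' : QReg n → ZMod 2} (h : IsAff2 g) (h' : IsAff2 g') : IsAff2 (fun x => g x + g' x) := by
  obtain ⟨α, b, hg⟩ := h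
  obtain ⟨α', b', hg'⟩ := h'
  refine ⟨α + α', b + b', fun x => ?_⟩
  dsimp only
  rw [hg x, hg' x]
  simp only [Pi.add_apply, add_mul, Finset.sum_add_distrib]
  ring

/-- Multiples of affine forms. [folklore] -/
theorem smul (a : ZMod 2) {g : QReg n → ZMod 2} (h : IsAff2 g) : IsAff2 (fun x => a * g x) := by
  obtain ⟨α, b, hg⟩ := h
  refine ⟨fun i => a * α i, a * b, fun x => ?_⟩
  dsimp only
  rw [hg x, mul_add, Finset.mul_sum]
  exact congrArg _ (Finset.sum_congr rfl fun i _ => by ring)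

/-- Finite sums of affine forms. [folklore] -/
theorem sum {ι : Type*} (s : Finset ι) (G : ι → QReg n → ZMod 2) (h : ∀ i ∈ s, IsAff2 (G i)) :
    IsAff2 (fun x => ∑ i ∈ s, G i x) := by
  classical
  induction s using Finset.induction_on with
  | empty => simpa using const (n := n) 0
  | insert a s ha ih =>
    have := (h a (Finset.mem_insert_self a s)).add (ih fun i hi => h i (Finset.mem_insert_of_mem hi))
    refine this.congr fun x => ?_
    rw [Finset.sum_insert ha]

/-- The coordinates of `x[j ↦ v]` are affine in `x`. [folklore] -/
theorem coord_update (j k : Fin n) (v : Bool) :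
    IsAff2 (fun x : QReg n => bz (Function.update x j v k)) := by
  by_cases hk : k = j
  · subst hk
    exact (const (bz v)).congr fun x => by simp
  · exact (coord k).congr fun x => by rw [Function.update_of_ne hk]

end IsAff2

namespace IsAffB

/-- `IsAffB` is extensional. [folklore] -/
theorem congr {f f' : QReg n → Bool} (h : IsAffB f) (e : ∀ x, f x = f' x) : IsAffB f' :=
  IsAff2.congr h fun x => by rw [e x]

/-- Constant Boolean functions are affine. [folklore] -/
theorem const (v : Bool) : IsAffB (fun _ : QReg n => v) := IsAff2.const (bz v)

/-- Coordinate bits are affine. [folklore] -/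
theorem coord (i : Fin n) : IsAffB (fun x : QReg n => x i) := IsAff2.coord i

/-- `xor` of affine Boolean functions. [folklore] -/
theorem xor {f f' : QReg n → Bool} (h : IsAffB f) (h' : IsAffB f') : IsAffB (fun x => (f x ^^ f' x)) :=
  (IsAff2.add h h').congr fun _ => (bz_xor _ _).symm

/-- The coordinates of `x[j ↦ v]` are affine Boolean functions of `x`. [folklore] -/
theorem coord_update (j k : Fin n) (v : Bool) : IsAffB (fun x : QReg n => Function.update x j v k) :=
  IsAff2.coord_update j k v

/-- `toBool ∘ g` is affine for affine `g`. [folklore] -/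
theorem of_isAff2 {g : QReg n → ZMod 2} (h : IsAff2 g) : IsAffB (fun x => toBool (g x)) :=
  IsAff2.congr h fun _ => (bz_toBool _).symm

end IsAffB

namespace IsQF

/-- `[f]` is a quadratic phase function for affine Boolean `f`. [folklore] -/
theorem of_isAffB {f : QReg n → Bool} (h : IsAffB f) : IsQF (fun x => bq (f x)) := by
  obtain ⟨α, b, hf⟩ := h
  exact (IsQF.lift_affine α b).congr fun x => by rw [← hf x, lift_bz]

/-- Quadratic phase functions are closed under affine substitutions of the coordinates.
[Dehaene–De Moor 2003, §IV] [folklore] -/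
theorem comp {p : QReg n → ZMod 4} (hp : IsQF p) (σ : QReg n → QReg n)
    (hσ : ∀ i, IsAffB (fun x => σ x i)) : IsQF (fun x => p (σ x)) := by
  obtain ⟨c, l, q, hp⟩ := hp
  have h1 : IsQF (fun x => ∑ i, l i * bq (σ x i)) :=
    IsQF.sum _ (fun i x => l i * bq (σ x i)) fun i _ => (of_isAffB (hσ i)).smul (l i)
  have h2 : IsQF (fun x => ∑ i, ∑ k, q i k * (2 * bq (σ x i) * bq (σ x k))) :=
    IsQF.sum _ (fun i x => ∑ k, q i k * (2 * bq (σ x i) * bq (σ x k))) fun i _ =>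
      IsQF.sum _ (fun k x => q i k * (2 * bq (σ x i) * bq (σ x k))) fun k _ =>
        ((of_isAffB (hσ i)).two_mul_mul (of_isAffB (hσ k))).smul (q i k)
  refine (((const c).add h1).add h2).congr fun x => ?_
  rw [hp (σ x), Finset.mul_sum]
  congr 1
  refine Finset.sum_congr rfl fun i _ => ?_
  rw [Finset.mul_sum]
  exact Finset.sum_congr rfl fun k _ => by ring

/-- **Flip difference.** For a quadratic phase function `p` and a coordinate `j`,
`p(x[j↦1]) − p(x[j↦0]) = e₀ + 2 Σ_k m_k [x[j↦0]_k]` with constants `e₀, m_k`. [folklore] -/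
theorem flip_diff {p : QReg n → ZMod 4} (hp : IsQF p) (j : Fin n) :
    ∃ (e₀ : ZMod 4) (m : Fin n → ZMod 4), ∀ x : QReg n,
      p (Function.update x j true) - p (Function.update x j false) =
        e₀ + 2 * ∑ k, m k * bq (Function.update x j false k) := by
  classical
  obtain ⟨c, l, q, hp⟩ := hp
  refine ⟨l j + 2 * q j j, fun k => q j k + q k j, fun x => ?_⟩
  set x0 := Function.update x j false with hx0
  set x1 := Function.update x j true with hx1
  set d : Fin n → ZMod 4 := fun i => if i = j then 1 else 0 with hd
  set u : Fin n → ZMod 4 := fun i => bq (x0 i) with hu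
  have hud : ∀ i, bq (x1 i) = u i + d i := by
    intro i
    by_cases hij : i = j
    · subst hij; simp [hu, hd, hx0, hx1]
    · simp [hu, hd, hx0, hx1, hij]
  have huj : u j = 0 := by simp [hu, hx0]
  rw [hp x1, hp x0]
  simp only [hud]
  change c + ∑ i, l i * (u i + d i) + 2 * ∑ i, ∑ k, q i k * ((u i + d i) * (u k + d k)) -
      (c + ∑ i, l i * u i + 2 * ∑ i, ∑ k, q i k * (u i * u k)) =
    l j + 2 * q j j + 2 * ∑ k, (q j k + q k j) * u k
  have s1 : ∑ i, l i * (u i + d i) = ∑ i, l i * u i + l j := by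
    simp only [mul_add, Finset.sum_add_distrib, hd, mul_ite, mul_one, mul_zero, Finset.sum_ite_eq',
      Finset.mem_univ, if_true]
  have s2 : ∑ i, ∑ k, q i k * ((u i + d i) * (u k + d k)) =
      ∑ i, ∑ k, q i k * (u i * u k) + (∑ i, q i j * u i + ∑ k, q j k * u k + q j j) := by
    have : ∀ i k, q i k * ((u i + d i) * (u k + d k)) =
        q i k * (u i * u k) + (q i k * u i * d k + q i k * d i * u k + q i k * d i * d k) := by
      intro i k; ring
    simp only [this, Finset.sum_add_distrib]
    congr 1
    have t1 : ∑ i, ∑ k, q i k * u i * d k = ∑ i, q i j * u i := by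
      refine Finset.sum_congr rfl fun i _ => ?_
      simp [hd, mul_ite, Finset.sum_ite_eq']
    have t2 : ∑ i, ∑ k, q i k * d i * u k = ∑ k, q j k * u k := by
      rw [Finset.sum_comm]
      refine Finset.sum_congr rfl fun k _ => ?_
      simp [hd, mul_ite, Finset.sum_ite_eq']
    have t3 : ∑ i, ∑ k, q i k * d i * d k = q j j := by
      simp [hd, mul_ite, Finset.sum_ite_eq']
    rw [t1, t2, t3]
  rw [s1, s2]
  have s3 : ∑ k, (q j k + q k j) * u k = ∑ k, q j k * u k + ∑ i, q i j * u i := by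
    rw [← Finset.sum_add_distrib]
    exact Finset.sum_congr rfl fun k _ => by ring
  rw [s3]
  ring

end IsQF

/-! ### Affine equations and the Dehaene–De Moor family -/

/-- An affine equation `b + Σ αᵢ xᵢ = 0` over `𝔽₂`. [folklore] -/
structure AffEq (n : ℕ) where
  /-- coefficients -/
  α : Fin n → ZMod 2
  /-- constant term -/
  b : ZMod 2

namespace AffEq

/-- The value `b + Σ αᵢ xᵢ` of the affine form at `x`. [folklore] -/
def eval (e : AffEq n) (x : QReg n) : ZMod 2 := e.b + ∑ i, e.α i * bz (x i)

/-- Sum of two affine forms. [folklore] -/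
def add (e e' : AffEq n) : AffEq n := ⟨e.α + e'.α, e.b + e'.b⟩

/-- Scalar multiple of an affine form. [folklore] -/
def smul (a : ZMod 2) (e : AffEq n) : AffEq n := ⟨fun i => a * e.α i, a * e.b⟩

/-- The form with the coefficient of `x_j` removed (`x_j := 0`). [folklore] -/
def restrict (j : Fin n) (e : AffEq n) : AffEq n := ⟨Function.update e.α j 0, e.b⟩

/-- Evaluation is additive. [folklore] -/
theorem eval_add (e e' : AffEq n) (x : QReg n) : (e.add e').eval x = e.eval x + e'.eval x := by
  simp only [eval, add, Pi.add_apply, add_mul, Finset.sum_add_distrib]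
  ring

/-- Evaluation commutes with scalars. [folklore] -/
theorem eval_smul (a : ZMod 2) (e : AffEq n) (x : QReg n) : (e.smul a).eval x = a * e.eval x := by
  simp only [eval, smul, mul_add, Finset.mul_sum, mul_assoc]

/-- Evaluating at `x[j ↦ v]` changes the value by `α_j (v − x_j)`. [folklore] -/
theorem eval_update (e : AffEq n) (x : QReg n) (j : Fin n) (v : Bool) :
    e.eval (Function.update x j v) = e.eval x + e.α j * (bz v - bz (x j)) := by
  classical
  simp only [eval]
  have : ∀ i, e.α i * bz (Function.update x j v i) =
      e.α i * bz (x i) + (if i = j then e.α j * (bz v - bz (x j)) else 0) := by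
    intro i
    by_cases hij : i = j
    · subst hij
      rw [Function.update_self, if_pos rfl]
      ring
    · simp [hij]
  simp only [this, Finset.sum_add_distrib, Finset.sum_ite_eq', Finset.mem_univ, if_true]
  ring

/-- The restricted form evaluates like the form at `x[j ↦ 0]`. [folklore] -/
theorem eval_restrict (j : Fin n) (e : AffEq n) (x : QReg n) :
    (e.restrict j).eval x = e.eval (Function.update x j false) := by
  classical
  simp only [eval, restrict]
  congr 1
  refine Finset.sum_congr rfl fun i _ => ?_
  by_cases hij : i = j
  · subst hij; simp
  · simp [hij]

/-- The value of an affine equation is an affine form. [folklore] -/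
theorem isAff2_eval (e : AffEq n) : IsAff2 e.eval := ⟨e.α, e.b, fun _ => rfl⟩

/-- Every affine form is the value of an affine equation. [folklore] -/
theorem exists_of_isAff2 {g : QReg n → ZMod 2} (hg : IsAff2 g) : ∃ e : AffEq n, ∀ x, e.eval x = g x := by
  obtain ⟨α, b, h⟩ := hg
  exact ⟨⟨α, b⟩, fun x => (h x).symm⟩

end AffEq

/-- `x` solves the system `E`. [folklore] -/
def Sol (E : List (AffEq n)) (x : QReg n) : Prop := ∀ e ∈ E, e.eval x = 0

/-- Solving a finite system is decidable. [folklore] -/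
instance (E : List (AffEq n)) : DecidablePred (Sol E) := fun x => by
  unfold Sol; infer_instance

/-- Solutions of a concatenated system. [folklore] -/
theorem sol_append (E E' : List (AffEq n)) (x : QReg n) : Sol (E ++ E') x ↔ Sol E x ∧ Sol E' x := by
  simp only [Sol, List.mem_append, or_imp, forall_and]

/-- Solutions of a mapped system. [folklore] -/
theorem sol_map {ι : Type*} (L : List ι) (f : ι → AffEq n) (x : QReg n) :
    Sol (L.map f) x ↔ ∀ i ∈ L, (f i).eval x = 0 := by
  simp only [Sol, List.forall_mem_map]

/-- The phase `i^a`, `a ∈ ℤ₄`. [folklore] -/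
def phase (a : ZMod 4) : ℂ := Complex.I ^ a.val

/-- `i^m` only depends on `m mod 4`. [folklore] -/
theorem I_pow_mod_four (m : ℕ) : Complex.I ^ (m % 4) = Complex.I ^ m := by
  conv_rhs => rw [← Nat.mod_add_div m 4, pow_add, pow_mul, Complex.I_pow_four, one_pow, mul_one]

/-- `i^{a+b} = i^a i^b` on `ℤ₄`. [folklore] -/
theorem phase_add (a b : ZMod 4) : phase (a + b) = phase a * phase b := by
  simp only [phase]
  rw [ZMod.val_add, I_pow_mod_four, pow_add]

/-- `i^0 = 1`. [folklore] -/
@[simp] theorem phase_zero : phase 0 = 1 := by simp [phase]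

/-- `i^{[b]}`. [folklore] -/
theorem phase_bq (b : Bool) : phase (bq b) = if b then Complex.I else 1 := by
  cases b
  · simp [phase]
  · show Complex.I ^ (1 : ZMod 4).val = _
    rw [show (1 : ZMod 4).val = 1 from rfl, pow_one]
    simp

/-- `i^{2[b]} = (−1)^b`. [folklore] -/
theorem phase_two_mul_bq (b : Bool) : phase (2 * bq b) = if b then -1 else 1 := by
  cases b
  · simp [phase]
  · show Complex.I ^ (2 * 1 : ZMod 4).val = _
    rw [show (2 * 1 : ZMod 4).val = 2 from rfl, Complex.I_sq]
    simp

/-- `i^{3[b]} = (−i)^b`. [folklore] -/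
theorem phase_three_mul_bq (b : Bool) : phase (3 * bq b) = if b then -Complex.I else 1 := by
  cases b
  · simp [phase]
  · show Complex.I ^ (3 * 1 : ZMod 4).val = _
    rw [show (3 * 1 : ZMod 4).val = 3 from rfl, pow_succ, Complex.I_sq]
    simp

/-- Phases are nonzero. [folklore] -/
theorem phase_ne_zero (a : ZMod 4) : phase a ≠ 0 := pow_ne_zero _ Complex.I_ne_zero

/-- **The Dehaene–De Moor family**: `x ↦ c · [x ⊨ E] · i^{p(x)}` for a system `E` of affine
equations over `𝔽₂`, a phase function `p` and a scalar `c`. Every stabilizer state is of this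
form with `p` quadratic (Dehaene–De Moor 2003, Thm. 5; Van den Nest 2010, §3). [folklore] -/
def ddm (E : List (AffEq n)) (p : QReg n → ZMod 4) (c : ℂ) : QReg n → ℂ :=
  fun x => if Sol E x then c * phase (p x) else 0

/-- `ψ` has a Dehaene–De Moor representation with a quadratic phase function. [folklore] -/
def Repr (ψ : QReg n → ℂ) : Prop :=
  ∃ (E : List (AffEq n)) (p : QReg n → ZMod 4) (c : ℂ), IsQF p ∧ ψ = ddm E p c

/-- Definitional unfolding of `ddm`. [folklore] -/
theorem ddm_apply (E : List (AffEq n)) (p : QReg n → ZMod 4) (c : ℂ) (x : QReg n) :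
    ddm E p c x = if Sol E x then c * phase (p x) else 0 := rfl

/-! ### The three Clifford generators preserve the family -/

/-- The family is closed under scalars. [folklore] -/
theorem repr_smul {ψ : QReg n → ℂ} (h : Repr ψ) (a : ℂ) : Repr (a • ψ) := by
  obtain ⟨E, p, c, hp, rfl⟩ := h
  refine ⟨E, p, a * c, hp, funext fun x => ?_⟩
  simp only [Pi.smul_apply, ddm_apply, smul_eq_mul]
  split_ifs <;> ring

/-- `|0ⁿ⟩` is in the family: equations `xᵢ = 0`, phase `0`. [folklore] -/
theorem repr_zeroState : Repr (zeroState n) := by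
  classical
  refine ⟨(List.finRange n).map (fun i => ⟨fun k => if k = i then 1 else 0, 0⟩), fun _ => 0, 1,
    IsQF.const 0, funext fun x => ?_⟩
  have hsol : Sol ((List.finRange n).map (fun i => (⟨fun k => if k = i then 1 else 0, 0⟩ : AffEq n))) x ↔
      x = fun _ => false := by
    rw [sol_map]
    simp only [List.mem_finRange, true_implies, AffEq.eval, zero_add, ite_mul, one_mul, zero_mul,
      Finset.sum_ite_eq', Finset.mem_univ, if_true, bz_eq_zero_iff]
    exact ⟨fun h => funext h, fun h i => by rw [h]⟩
  rw [zeroState, basisState_apply, ddm_apply]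
  simp only [phase_zero, mul_one]
  by_cases hx : x = fun _ => false
  · rw [if_pos hx, if_pos (hsol.2 hx)]
  · rw [if_neg hx, if_neg (fun h => hx (hsol.1 h))]

/-- The `S` gate on wire `j` in the Schrödinger picture: `(S_j v)(y) = i^{y_j} v(y)`. [folklore] -/
theorem sGate_mulVec_apply (j : Fin n) (v : QReg n → ℂ) (y : QReg n) :
    (placeGate (wireEmb j) sGate *ᵥ v) y = (if y j = true then Complex.I else 1) * v y := by
  rw [LightCone.placeGate_wireEmb_mulVec_apply]
  cases hy : y j
  · have h1 : Function.update y j false = y := by rw [← hy, Function.update_eq_self]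
    simp [sGate, funext_iff, h1]
  · have h1 : Function.update y j true = y := by rw [← hy, Function.update_eq_self]
    simp [sGate, funext_iff, h1]

/-- The Hadamard gate on wire `j` in the Schrödinger picture. [folklore] -/
theorem hGate_mulVec_apply (j : Fin n) (v : QReg n → ℂ) (y : QReg n) :
    (placeGate (wireEmb j) hGate *ᵥ v) y =
      invSqrt2 * (v (Function.update y j false) +
        (if y j = true then -1 else 1) * v (Function.update y j true)) := by
  rw [LightCone.placeGate_wireEmb_mulVec_apply]
  cases y j <;> simp [hGate, invSqrt2] <;> ring

/-- `CNOT` (control `a`, target `b`) in the Schrödinger picture: `(CNOT v)(y) = v(y[b ↦ y_b ⊕ y_a])`.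
[folklore] -/
theorem cnot_mulVec_apply (a b : Fin n) (h : a ≠ b) (v : QReg n → ℂ) (y : QReg n) :
    (placeGate (pairEmb a b h) cnot *ᵥ v) y = v (Function.update y b (y b ^^ y a)) := by
  refine LightCone.mulVec_apply_of_perm (π := fun w => Function.update w b (w b ^^ w a))
    (fun w => ?_) (fun w => ?_) v y
  · show Function.update (Function.update w b (w b ^^ w a)) b
        ((Function.update w b (w b ^^ w a)) b ^^ (Function.update w b (w b ^^ w a)) a) = w
    rw [Function.update_idem, Function.update_self, Function.update_of_ne h, Bool.xor_assoc, Bool.xor_self,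
      Bool.xor_false, Function.update_eq_self]
  · have := cnotOn_mulVec_basisState 0 a b h w
    rwa [cnotOn_toMatrix] at this

/-- **`S` preserves the family**: the phase function gains `[x_j]`. [Dehaene–De Moor 2003] [folklore] -/
theorem repr_sGate (j : Fin n) {ψ : QReg n → ℂ} (h : Repr ψ) : Repr (placeGate (wireEmb j) sGate *ᵥ ψ) := by
  obtain ⟨E, p, c, hp, rfl⟩ := h
  refine ⟨E, fun x => p x + bq (x j), c, hp.add (IsQF.coord j), funext fun y => ?_⟩
  rw [sGate_mulVec_apply, ddm_apply, ddm_apply]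
  by_cases hs : Sol E y
  · rw [if_pos hs, if_pos hs, phase_add, phase_bq]
    split_ifs <;> ring
  · rw [if_neg hs, if_neg hs, mul_zero]

/-- **`CNOT` preserves the family**: substitute `x_b := x_b ⊕ x_a` in equations and phase.
[Dehaene–De Moor 2003] [folklore] -/
theorem repr_cnot (a b : Fin n) (hab : a ≠ b) {ψ : QReg n → ℂ} (h : Repr ψ) :
    Repr (placeGate (pairEmb a b hab) cnot *ᵥ ψ) := by
  classical
  obtain ⟨E, p, c, hp, rfl⟩ := h
  let τ : QReg n → QReg n := fun y => Function.update y b (y b ^^ y a)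
  have hτ : ∀ i, IsAffB (fun y => τ y i) := by
    intro i
    by_cases hib : i = b
    · subst hib
      exact ((IsAffB.coord i).xor (IsAffB.coord a)).congr fun y => by simp [τ]
    · exact (IsAffB.coord i).congr fun y => by simp [τ, Function.update_of_ne hib]
  let f : AffEq n → AffEq n := fun e => ⟨fun i => e.α i + (if i = a then e.α b else 0), e.b⟩
  have hf : ∀ e : AffEq n, ∀ y, (f e).eval y = e.eval (τ y) := by
    intro e y
    simp only [τ, AffEq.eval_update, bz_xor]
    simp only [AffEq.eval, f, add_mul, Finset.sum_add_distrib, ite_mul, zero_mul, Finset.sum_ite_eq',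
      Finset.mem_univ, if_true]
    ring
  refine ⟨E.map f, fun y => p (τ y), c, hp.comp τ hτ, funext fun y => ?_⟩
  rw [cnot_mulVec_apply, ddm_apply, ddm_apply]
  have : Sol (E.map f) y ↔ Sol E (τ y) := by
    rw [sol_map]
    simp only [Sol, hf]
  simp only [this, τ]

/-- **`H` preserves the family** (the heart of Dehaene–De Moor's theorem): case analysis on
whether some equation mentions `x_j`, and on the parity of the flip difference of the phase.
[Dehaene–De Moor 2003, Thm. 5; Van den Nest 2010, §3] [folklore] -/
theorem repr_hGate (j : Fin n) {ψ : QReg n → ℂ} (h : Repr ψ) : Repr (placeGate (wireEmb j) hGate *ᵥ ψ) := by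
  classical
  obtain ⟨E, p, c, hp, rfl⟩ := h
  have key : ∀ y : QReg n, (placeGate (wireEmb j) hGate *ᵥ ddm E p c) y =
      invSqrt2 * (ddm E p c (Function.update y j false) +
        (if y j = true then -1 else 1) * ddm E p c (Function.update y j true)) :=
    fun y => hGate_mulVec_apply j _ y
  by_cases hE : ∃ e ∈ E, e.α j ≠ 0
  · /- Case B: some equation `e₀` mentions `x_j`; eliminate `x_j` with it. -/
    obtain ⟨e₀, he₀E, he₀j⟩ := hE
    have hα : e₀.α j = 1 := zmod2_eq_one_of_ne_zero he₀j
    -- the eliminated bit as an affine function of the other bits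
    let β : QReg n → Bool := fun y => toBool (e₀.eval (Function.update y j false))
    have hβ : IsAffB β := IsAffB.of_isAff2
      ((e₀.restrict j).isAff2_eval.congr fun y => AffEq.eval_restrict j e₀ y)
    have hβval : ∀ y, bz (β y) = e₀.eval (Function.update y j false) := fun y => bz_toBool _
    let σ : QReg n → QReg n := fun y => Function.update y j (β y)
    have hσ : ∀ i, IsAffB (fun y => σ y i) := by
      intro i
      by_cases hij : i = j
      · subst hij; exact hβ.congr fun y => by simp [σ]
      · exact (IsAffB.coord i).congr fun y => by simp [σ, Function.update_of_ne hij]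
    -- `e₀` holds at `y[j ↦ β y]` and fails at `y[j ↦ ¬β y]`
    have hrel : ∀ (e : AffEq n) (y : QReg n) (v : Bool),
        e.eval (Function.update y j v) = e.eval (Function.update y j false) + e.α j * bz v := by
      intro e y v
      have := AffEq.eval_update e (Function.update y j false) j v
      simp only [Function.update_idem, Function.update_self, bz_false, sub_zero] at this
      exact this
    have he₀σ : ∀ y, e₀.eval (Function.update y j (β y)) = 0 := by
      intro y
      rw [hrel, hα, one_mul, ← hβval y, zmod2_add_self]
    have he₀flip : ∀ y, e₀.eval (Function.update y j (!β y)) ≠ 0 := by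
      intro y
      rw [hrel, hα, one_mul, ← hβval y]
      cases β y <;> decide
    -- the new equations: `x_j` eliminated
    let f : AffEq n → AffEq n := fun e => (e.add (e₀.smul (e.α j))).restrict j
    have hf : ∀ e y, (f e).eval y = e.eval (Function.update y j false) +
        e.α j * e₀.eval (Function.update y j false) := by
      intro e y
      simp only [f, AffEq.eval_restrict, AffEq.eval_add, AffEq.eval_smul]
    have hsol : ∀ y, Sol (E.map f) y ↔ Sol E (Function.update y j (β y)) := by
      intro y
      rw [sol_map]
      unfold Sol
      constructor
      · intro hy e he
        rw [hrel, hβval]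
        have h1 := hy e he
        rw [hf] at h1
        exact h1
      · intro hy e he
        rw [hf, ← hβval, ← hrel]
        exact hy e he
    refine ⟨E.map f, fun y => p (Function.update y j (β y)) + 2 * bq (y j) * bq (β y), invSqrt2 * c,
      (hp.comp σ hσ).add ((IsQF.coord j).two_mul_mul (IsQF.of_isAffB hβ)), funext fun y => ?_⟩
    rw [key y]
    simp only [ddm_apply]
    have hnot : ¬ Sol E (Function.update y j (!β y)) := fun hs => he₀flip y (hs e₀ he₀E)
    have hsol' := hsol y
    cases hβy : β y
    · rw [hβy] at hnot hsol'
      rw [Bool.not_false] at hnot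
      rw [if_neg hnot]
      by_cases hs : Sol E (Function.update y j false)
      · rw [if_pos hs, if_pos (hsol'.2 hs), phase_add, mul_assoc (2 : ZMod 4), ← bq_and]
        simp only [Bool.and_false, bq_false, mul_zero, phase_zero, add_zero, mul_one]
        ring
      · rw [if_neg hs, if_neg (fun h => hs (hsol'.1 h))]
        ring
    · rw [hβy] at hnot hsol'
      rw [Bool.not_true] at hnot
      rw [if_neg hnot]
      by_cases hs : Sol E (Function.update y j true)
      · rw [if_pos hs, if_pos (hsol'.2 hs), phase_add, mul_assoc (2 : ZMod 4), ← bq_and, Bool.and_true,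
          phase_two_mul_bq]
        split_ifs <;> ring
      · rw [if_neg hs, if_neg (fun h => hs (hsol'.1 h))]
        ring
  · /- Case A: no equation mentions `x_j`. -/
    push Not at hE
    have hsol0 : ∀ y v, Sol E (Function.update y j v) ↔ Sol E y := by
      intro y v
      simp only [Sol]
      refine forall₂_congr fun e he => ?_
      rw [AffEq.eval_update, hE e he, zero_mul, add_zero]
    obtain ⟨e₀, m, hflip⟩ := hp.flip_diff j
    -- the affine form governing the interference of the two branches
    let w : QReg n → ZMod 4 := fun y =>
      bq (hi e₀) + ∑ k, m k * bq (Function.update y j false k) + bq (y j)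
    let fb : QReg n → Bool := fun y => toBool (red (w y))
    have hfb2 : IsAff2 (fun y => red (w y)) := by
      have : IsAff2 (fun y : QReg n => red (bq (hi e₀)) +
          ∑ k, red (m k) * bz (Function.update y j false k) + bz (y j)) :=
        ((IsAff2.const _).add (IsAff2.sum _ (fun k y => red (m k) * bz (Function.update y j false k))
          fun k _ => (IsAff2.coord_update j k false).smul (red (m k)))).add (IsAff2.coord j)
      refine this.congr fun y => ?_
      simp only [w, red_add, red_sum, red_mul, red_bq]
    have hfb : IsAffB fb := IsAffB.of_isAff2 hfb2
    -- the interference exponent `p(y¹) - p(y⁰) + 2[y_j] = lift (red e₀) + 2 [fb y]`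
    have hinter : ∀ y, p (Function.update y j true) - p (Function.update y j false) + 2 * bq (y j) =
        lift (red e₀) + 2 * bq (fb y) := by
      intro y
      rw [hflip y]
      have h2 : 2 * bq (fb y) = 2 * w y := by
        simp only [fb]
        rw [two_mul_eq_two_mul_lift_red (w y)]
        congr 1
        rw [← lift_bz, bz_toBool]
      rw [h2]
      simp only [w]
      conv_lhs => rw [eq_lift_red_add e₀]
      ring
    have hπ0 : ∀ i, IsAffB (fun y : QReg n => Function.update y j false i) :=
      fun i => IsAffB.coord_update j i false
    -- the value of `H_j ψ`
    have hval : ∀ y, (placeGate (wireEmb j) hGate *ᵥ ddm E p c) y =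
        if Sol E y then invSqrt2 * c * phase (p (Function.update y j false)) *
          (1 + phase (lift (red e₀)) * phase (2 * bq (fb y))) else 0 := by
      intro y
      rw [key y]
      simp only [ddm_apply, hsol0]
      by_cases hs : Sol E y
      · simp only [hs, if_true]
        have hph : phase (p (Function.update y j true)) =
            phase (p (Function.update y j false)) * phase (lift (red e₀)) * phase (2 * bq (fb y)) *
              phase (2 * bq (y j)) := by
          rw [← phase_add, ← phase_add, ← phase_add]
          congr 1
          have h1 := hinter y
          have e4 : (2 : ZMod 4) * bq (y j) + 2 * bq (y j) = 0 := by
            rw [← add_mul, show (2 : ZMod 4) + 2 = 0 from by decide, zero_mul]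
          linear_combination h1 - e4
        rw [hph, phase_two_mul_bq (y j)]
        split_ifs <;> ring
      · simp [hs]
    rcases lift_eq_zero_or_one (red e₀) with h0 | h1
    · /- even interference: a new equation `fb = 0` and a factor `2` -/
      obtain ⟨enew, henew⟩ := AffEq.exists_of_isAff2 hfb2
      refine ⟨E ++ [enew], fun y => p (Function.update y j false), 2 * invSqrt2 * c,
        hp.comp _ hπ0, funext fun y => ?_⟩
      rw [hval y, ddm_apply, h0, phase_zero, one_mul]
      have hsol' : Sol (E ++ [enew]) y ↔ Sol E y ∧ fb y = false := by
        rw [sol_append]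
        refine and_congr Iff.rfl ?_
        simp only [Sol, List.mem_singleton, forall_eq, henew]
        simp [fb, toBool]
      by_cases hs : Sol E y
      · rw [if_pos hs, phase_two_mul_bq]
        by_cases hfy : fb y = true
        · rw [if_pos hfy, if_neg (fun h' => absurd (hsol'.1 h').2 (by rw [hfy]; decide))]
          ring
        · have hfy' : fb y = false := by simpa using hfy
          rw [if_neg hfy, if_pos (hsol'.2 ⟨hs, hfy'⟩)]
          ring
      · rw [if_neg hs, if_neg (fun h' => hs (hsol'.1 h').1)]
    · /- odd interference: the phase function gains `3 [fb]`, the scalar a factor `1 + i` -/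
      refine ⟨E, fun y => p (Function.update y j false) + 3 * bq (fb y), invSqrt2 * c * (1 + Complex.I),
        (hp.comp _ hπ0).add ((IsQF.of_isAffB hfb).smul 3), funext fun y => ?_⟩
      have hI1 : phase (1 : ZMod 4) = Complex.I := by
        rw [phase, show (1 : ZMod 4).val = 1 from rfl, pow_one]
      rw [hval y, ddm_apply, h1, phase_add, phase_three_mul_bq, phase_two_mul_bq, hI1]
      by_cases hs : Sol E y
      · rw [if_pos hs, if_pos hs]
        by_cases hfy : fb y = true
        · rw [if_pos hfy, if_pos hfy]
          linear_combination (invSqrt2 * c * phase (p (Function.update y j false))) * Complex.I_sq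
        · rw [if_neg hfy, if_neg hfy]
          ring
      · rw [if_neg hs, if_neg hs]

/-! ### Every stabilizer state is in the family -/

/-- Retyping of placements of the Clifford gate set. [folklore] -/
abbrev cembH (e : Fin (clifford.arity CliffordOp.H) ↪ Fin n) : Fin 1 ↪ Fin n := e
/-- Retyping of placements of the Clifford gate set. [folklore] -/
abbrev cembS (e : Fin (clifford.arity CliffordOp.S) ↪ Fin n) : Fin 1 ↪ Fin n := e
/-- Retyping of placements of the Clifford gate set. [folklore] -/
abbrev cembC (e : Fin (clifford.arity CliffordOp.CNOT) ↪ Fin n) : Fin 2 ↪ Fin n := e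

/-- Every placement of a Clifford gate preserves the family. [Dehaene–De Moor 2003, Thm. 5] [folklore] -/
theorem repr_mulVec_of_mem_placements {M : Matrix (QReg n) (QReg n) ℂ} (hM : M ∈ placements clifford n)
    {ψ : QReg n → ℂ} (hψ : Repr ψ) : Repr (M *ᵥ ψ) := by
  obtain ⟨g, e, rfl⟩ := hM
  cases g with
  | H =>
    have : placeGate e (clifford.mat CliffordOp.H) = placeGate (wireEmb (cembH e 0)) hGate :=
      congrArg (fun e' : Fin 1 ↪ Fin n => placeGate e' hGate) (emb_one_eq_wireEmb (cembH e))
    rw [this]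
    exact repr_hGate _ hψ
  | S =>
    have : placeGate e (clifford.mat CliffordOp.S) = placeGate (wireEmb (cembS e 0)) sGate :=
      congrArg (fun e' : Fin 1 ↪ Fin n => placeGate e' sGate) (emb_one_eq_wireEmb (cembS e))
    rw [this]
    exact repr_sGate _ hψ
  | CNOT =>
    have : placeGate e (clifford.mat CliffordOp.CNOT) =
        placeGate (pairEmb (cembC e 0) (cembC e 1) (emb_two_ne (cembC e))) cnot :=
      congrArg (fun e' : Fin 2 ↪ Fin n => placeGate e' cnot) (emb_two_eq_pairEmb (cembC e))
    rw [this]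
    exact repr_cnot _ _ _ hψ

/-- Every Clifford circuit preserves the family (closure induction). [Dehaene–De Moor 2003, Thm. 5]
[folklore] -/
theorem repr_mulVec_of_mem_cliffordCircuits {C : Matrix (QReg n) (QReg n) ℂ} (hC : C ∈ cliffordCircuits n) :
    ∀ ψ : QReg n → ℂ, Repr ψ → Repr (C *ᵥ ψ) := by
  unfold cliffordCircuits at hC
  induction hC using Submonoid.closure_induction with
  | mem M hM => exact fun ψ h => repr_mulVec_of_mem_placements hM h
  | one => intro ψ h; simpa using h
  | mul M M' _ _ ih ih' =>
    intro ψ h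
    rw [← Matrix.mulVec_mulVec]
    exact ih _ (ih' _ h)

/-- **Dehaene–De Moor normal form**: every stabilizer state is `c · [x ⊨ E] · i^{p(x)}` with `p`
quadratic. [Dehaene–De Moor 2003, Thm. 5; Van den Nest 2010, §3] [folklore] -/
theorem repr_of_mem_stabilizerStates {φ : QReg n → ℂ} (h : φ ∈ stabilizerStates n) : Repr φ := by
  obtain ⟨C, hC, rfl⟩ := h
  exact repr_mulVec_of_mem_cliffordCircuits hC _ repr_zeroState

/-! ### A finite parametrisation of the family up to scalars -/

/-- `𝔽₂ⁿ` as a vector space over `𝔽₂`. [folklore] -/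
abbrev V (n : ℕ) : Type := Fin n → ZMod 2

/-- A register label as a vector of `𝔽₂ⁿ`. [folklore] -/
def toV (x : QReg n) : V n := fun i => bz (x i)

/-- Parameters of the normal form: a base point and `n` spanning vectors of the support, and the
linear and quadratic phase coefficients (`2^{3n²+3n}` parameters in all). [folklore] -/
abbrev Param (n : ℕ) : Type := (V n × (Fin n → V n)) × ((Fin n → ZMod 4) × (Fin n → Fin n → ZMod 4))

/-- The quadratic phase function with coefficients `l, q` (no constant term). [folklore] -/
def qf (l : Fin n → ZMod 4) (q : Fin n → Fin n → ZMod 4) (x : QReg n) : ZMod 4 :=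
  ∑ i, l i * bq (x i) + 2 * ∑ i, ∑ k, q i k * (bq (x i) * bq (x k))

open Classical in
/-- The normalised vector of a parameter: `x ↦ [x − a ∈ span v] · i^{qf l q x}`. [folklore] -/
def vec (P : Param n) : QReg n → ℂ := fun x =>
  if toV x - P.1.1 ∈ Submodule.span (ZMod 2) (Set.range P.1.2) then phase (qf P.2.1 P.2.2 x) else 0

/-- The number of parameters is `2^{3n² + 3n}`. [folklore] -/
theorem card_param (n : ℕ) : Fintype.card (Param n) = 2 ^ (3 * n ^ 2 + 3 * n) := by
  simp only [Fintype.card_prod, Fintype.card_fun, ZMod.card, Fintype.card_fin]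
  rw [show (4 : ℕ) = 2 ^ 2 from rfl, ← pow_mul, ← pow_mul]
  ring

/-- Every subspace of `𝔽₂ⁿ` is spanned by (at most) `n` vectors. [folklore] -/
theorem exists_fin_span (K : Submodule (ZMod 2) (V n)) :
    ∃ v : Fin n → V n, Submodule.span (ZMod 2) (Set.range v) = K := by
  classical
  let b := Module.finBasis (ZMod 2) K
  have hd : Module.finrank (ZMod 2) K ≤ n := by
    have := Submodule.finrank_le K
    rwa [Module.finrank_fin_fun] at this
  refine ⟨fun i => if h : (i : ℕ) < Module.finrank (ZMod 2) K then (b ⟨i, h⟩ : V n) else 0,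
    le_antisymm ?_ ?_⟩
  · refine Submodule.span_le.2 ?_
    rintro _ ⟨i, rfl⟩
    dsimp only
    split_ifs with h
    · exact (b ⟨i, h⟩).2
    · exact K.zero_mem
  · intro w hw
    have hsum : (w : V n) = ∑ i, (b.repr ⟨w, hw⟩ i) • (b i : V n) := by
      conv_lhs => rw [show w = ((⟨w, hw⟩ : K) : V n) from rfl, ← b.sum_repr ⟨w, hw⟩]
      simp only [Submodule.coe_sum, Submodule.coe_smul]
    rw [hsum]
    refine Submodule.sum_mem _ fun i _ => Submodule.smul_mem _ _ (Submodule.subset_span ⟨Fin.castLE hd i, ?_⟩)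
    simp only [Fin.val_castLE, Fin.is_lt, dif_pos, Fin.eta]

/-- **Every stabilizer direction is a parameter vector**: a vector of the Dehaene–De Moor family
is a scalar multiple of some `vec P`. [folklore] -/
theorem exists_param_of_repr {φ : QReg n → ℂ} (h : Repr φ) : ∃ (P : Param n) (c : ℂ), φ = c • vec P := by
  classical
  obtain ⟨E, p, c, ⟨c₀, l, q, hp⟩, rfl⟩ := h
  by_cases hne : ∃ x₀, Sol E x₀
  · obtain ⟨x₀, hx₀⟩ := hne
    have hadd : ∀ (e : AffEq n) (v w : V n),
        ∑ i, e.α i * (v + w) i = ∑ i, e.α i * v i + ∑ i, e.α i * w i := by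
      intro e v w
      simp only [Pi.add_apply, mul_add, Finset.sum_add_distrib]
    have hsmul : ∀ (e : AffEq n) (a : ZMod 2) (v : V n), ∑ i, e.α i * (a • v) i = a * ∑ i, e.α i * v i := by
      intro e a v
      rw [Finset.mul_sum]
      exact Finset.sum_congr rfl fun i _ => by simp only [Pi.smul_apply, smul_eq_mul]; ring
    let K : Submodule (ZMod 2) (V n) :=
      { carrier := {v | ∀ e ∈ E, ∑ i, e.α i * v i = 0}
        add_mem' := fun {v w} hv hw e he => by rw [hadd, hv e he, hw e he, add_zero]
        zero_mem' := fun e _ => by simp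
        smul_mem' := fun a v hv e he => by rw [hsmul, hv e he, mul_zero] }
    have hK : ∀ x, Sol E x ↔ toV x - toV x₀ ∈ K := by
      intro x
      show (∀ e ∈ E, e.eval x = 0) ↔ ∀ e ∈ E, ∑ i, e.α i * (toV x - toV x₀) i = 0
      refine forall₂_congr fun e he => ?_
      have hsub : ∑ i, e.α i * (toV x - toV x₀) i = e.eval x - e.eval x₀ := by
        simp only [AffEq.eval, toV, Pi.sub_apply, mul_sub, Finset.sum_sub_distrib]
        ring
      rw [hsub, hx₀ e he, sub_zero]
    obtain ⟨v, hv⟩ := exists_fin_span K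
    refine ⟨((toV x₀, v), (l, q)), c * phase c₀, funext fun x => ?_⟩
    have hpx : p x = c₀ + qf l q x := by rw [hp x, qf]; ring
    simp only [Pi.smul_apply, smul_eq_mul, vec, ddm_apply, hv]
    by_cases hs : Sol E x
    · rw [if_pos hs, if_pos ((hK x).1 hs), hpx, phase_add]
      ring
    · rw [if_neg hs, if_neg (fun h' => hs ((hK x).2 h')), mul_zero]
  · push Not at hne
    refine ⟨default, 0, funext fun x => ?_⟩
    simp [ddm_apply, hne x]

/-- **Counting stabilizer directions** (the quantitative content of Aaronson–Gottesman's count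
`2ⁿ ∏ (2^k + 1) ≤ 2^{(1/2 + o(1)) n²}`, here crudely `≤ 2^{3n²+3n}`): every stabilizer state
is a scalar multiple of one of the `2^{3n²+3n}` vectors `vec P`.
[Aaronson–Gottesman 2004, §I; Dehaene–De Moor 2003, Thm. 5] [folklore] -/
theorem exists_param_of_mem_stabilizerStates {φ : QReg n → ℂ} (h : φ ∈ stabilizerStates n) :
    ∃ (P : Param n) (c : ℂ), φ = c • vec P :=
  exists_param_of_repr (repr_of_mem_stabilizerStates h)

/-! ### Random sign vectors: Hoeffding's bound by the exponential moment -/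

section Signs

variable {X : Type*} [Fintype X] [DecidableEq X]

/-- The sign `(−1)^b`. [folklore] -/
def sgn (b : Bool) : ℝ := if b then -1 else 1

/-- `sgn true = −1`. [folklore] -/
@[simp] theorem sgn_true : sgn true = -1 := by simp [sgn]
/-- `sgn false = 1`. [folklore] -/
@[simp] theorem sgn_false : sgn false = 1 := by simp [sgn]
/-- Signs square to one. [folklore] -/
@[simp] theorem sgn_mul_self (b : Bool) : sgn b * sgn b = 1 := by cases b <;> simp
/-- Signs square to one. [folklore] -/
theorem sgn_sq (b : Bool) : sgn b ^ 2 = 1 := by rw [sq, sgn_mul_self]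

/-- The exponential moment of a Rademacher sum factorises:
`Σ_s exp(t Σ_x ε_s(x) u_x) = ∏_x (e^{t u_x} + e^{−t u_x})`. [folklore] -/
theorem sum_exp_sgn_sum (u : X → ℝ) (t : ℝ) :
    ∑ s : X → Bool, Real.exp (t * ∑ x, sgn (s x) * u x) =
      ∏ x, (Real.exp (t * u x) + Real.exp (-(t * u x))) := by
  have h1 : ∀ s : X → Bool, Real.exp (t * ∑ x, sgn (s x) * u x) = ∏ x, Real.exp (t * (sgn (s x) * u x)) := by
    intro s
    rw [Finset.mul_sum, Real.exp_sum]
  simp_rw [h1]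
  have h2 := Finset.prod_univ_sum (fun _ : X => (Finset.univ : Finset Bool))
    (fun x b => Real.exp (t * (sgn b * u x)))
  rw [Fintype.piFinset_univ] at h2
  rw [← h2]
  refine Finset.prod_congr rfl fun x _ => ?_
  rw [Fintype.sum_bool, sgn_true, sgn_false, neg_one_mul, one_mul, mul_neg, add_comm]

/-- **Hoeffding's inequality for Rademacher sums, counting form**: for `T ≥ 0` and `Σ u² > 0`,
`#{s : Σ_x ε_s(x) u_x ≥ T} ≤ 2^{|X|} exp(−T²/(2 Σ u²))` (exponential moment with
`cosh y ≤ exp(y²/2)` and the optimal `λ = T / Σu²`). [folklore] -/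
theorem card_signs_sum_ge_le (u : X → ℝ) {T : ℝ} (hT : 0 ≤ T) (hU : 0 < ∑ x, u x ^ 2) :
    ((Finset.univ.filter fun s : X → Bool => T ≤ ∑ x, sgn (s x) * u x).card : ℝ) ≤
      2 ^ Fintype.card X * Real.exp (-(T ^ 2 / (2 * ∑ x, u x ^ 2))) := by
  have hlam0 : 0 ≤ T / ∑ x, u x ^ 2 := div_nonneg hT hU.le
  have step : ((Finset.univ.filter fun s : X → Bool => T ≤ ∑ x, sgn (s x) * u x).card : ℝ) *
      Real.exp (T / (∑ x, u x ^ 2) * T) ≤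
        2 ^ Fintype.card X * Real.exp ((T / ∑ x, u x ^ 2) ^ 2 * (∑ x, u x ^ 2) / 2) := by
    calc ((Finset.univ.filter fun s : X → Bool => T ≤ ∑ x, sgn (s x) * u x).card : ℝ) *
          Real.exp (T / (∑ x, u x ^ 2) * T)
        = ∑ _s ∈ Finset.univ.filter (fun s : X → Bool => T ≤ ∑ x, sgn (s x) * u x),
            Real.exp (T / (∑ x, u x ^ 2) * T) := by
          rw [Finset.sum_const, nsmul_eq_mul]
      _ ≤ ∑ s ∈ Finset.univ.filter (fun s : X → Bool => T ≤ ∑ x, sgn (s x) * u x),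
            Real.exp (T / (∑ x, u x ^ 2) * ∑ x, sgn (s x) * u x) := by
          refine Finset.sum_le_sum fun s hs => Real.exp_le_exp.2 ?_
          exact mul_le_mul_of_nonneg_left (Finset.mem_filter.1 hs).2 hlam0
      _ ≤ ∑ s : X → Bool, Real.exp (T / (∑ x, u x ^ 2) * ∑ x, sgn (s x) * u x) :=
          Finset.sum_le_univ_sum_of_nonneg fun s => (Real.exp_pos _).le
      _ = ∏ x, (Real.exp (T / (∑ x, u x ^ 2) * u x) + Real.exp (-(T / (∑ x, u x ^ 2) * u x))) :=
          sum_exp_sgn_sum u _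
      _ ≤ ∏ x, 2 * Real.exp ((T / (∑ x, u x ^ 2) * u x) ^ 2 / 2) := by
          refine Finset.prod_le_prod (fun x _ => by positivity) fun x _ => ?_
          have := Real.cosh_le_exp_half_sq (T / (∑ x, u x ^ 2) * u x)
          rw [Real.cosh_eq] at this
          linarith
      _ = 2 ^ Fintype.card X * Real.exp ((T / ∑ x, u x ^ 2) ^ 2 * (∑ x, u x ^ 2) / 2) := by
          rw [Finset.prod_mul_distrib, Finset.prod_const, Finset.card_univ, ← Real.exp_sum]
          congr 2
          rw [Finset.mul_sum, Finset.sum_div]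
          exact Finset.sum_congr rfl fun x _ => by ring
  have hkey : Real.exp ((T / ∑ x, u x ^ 2) ^ 2 * (∑ x, u x ^ 2) / 2) =
      Real.exp (-(T ^ 2 / (2 * ∑ x, u x ^ 2))) * Real.exp (T / (∑ x, u x ^ 2) * T) := by
    rw [← Real.exp_add]
    congr 1
    field_simp
    ring
  rw [hkey, ← mul_assoc] at step
  exact le_of_mul_le_mul_right step (Real.exp_pos _)

/-- The normalised sign vector `x ↦ ε_s(x)/√|X|` as a complex vector. [folklore] -/
def signVec (s : X → Bool) : X → ℂ := fun x => ((sgn (s x) / Real.sqrt (Fintype.card X) : ℝ) : ℂ)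

/-- `|a − w|² = a² − 2a Re w + |w|²` for real `a`. [folklore] -/
theorem norm_sq_real_sub (a : ℝ) (w : ℂ) : ‖(a : ℂ) - w‖ ^ 2 = a ^ 2 - 2 * a * w.re + ‖w‖ ^ 2 := by
  rw [Complex.sq_norm, Complex.sq_norm, Complex.normSq_apply, Complex.normSq_apply]
  simp only [Complex.sub_re, Complex.sub_im, Complex.ofReal_re, Complex.ofReal_im]
  ring

omit [DecidableEq X] in
/-- The squared distance from a sign vector: `‖ε_s/√D − w‖² = 1 − (2/√D) Σ ε_s(x) Re w_x + ‖w‖²`.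
[folklore] -/
theorem sum_norm_sq_signVec_sub [Nonempty X] (s : X → Bool) (w : X → ℂ) :
    ∑ x, ‖signVec s x - w x‖ ^ 2 =
      1 - 2 / Real.sqrt (Fintype.card X) * ∑ x, sgn (s x) * (w x).re + ∑ x, ‖w x‖ ^ 2 := by
  have hD : (0 : ℝ) < Fintype.card X := Nat.cast_pos.2 Fintype.card_pos
  simp only [signVec, norm_sq_real_sub, Finset.sum_add_distrib, Finset.sum_sub_distrib]
  congr 1
  congr 1
  · simp only [div_pow, sgn_sq, Real.sq_sqrt hD.le, Finset.sum_const, Finset.card_univ, nsmul_eq_mul]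
    field_simp
  · rw [Finset.mul_sum]
    exact Finset.sum_congr rfl fun x _ => by ring

/-- **Few sign vectors are close to any fixed vector**: for `δ'² < 1`,
`#{s : ‖ε_s/√D − w‖² ≤ δ'²} ≤ 2^D exp(−D(1−δ'²)/2)`, `D = |X|`. [folklore] -/
theorem card_signVec_close_le [Nonempty X] (w : X → ℂ) {δ' : ℝ} (hδ' : δ' ^ 2 < 1) :
    ((Finset.univ.filter fun s : X → Bool => ∑ x, ‖signVec s x - w x‖ ^ 2 ≤ δ' ^ 2).card : ℝ) ≤
      2 ^ Fintype.card X * Real.exp (-(Fintype.card X * (1 - δ' ^ 2) / 2)) := by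
  set D : ℝ := (Fintype.card X : ℝ) with hDdef
  have hD : 0 < D := Nat.cast_pos.2 Fintype.card_pos
  set ρ2 := ∑ x, ‖w x‖ ^ 2 with hρ2
  have hρ2nn : 0 ≤ ρ2 := Finset.sum_nonneg fun x _ => by positivity
  set u : X → ℝ := fun x => (w x).re with hu
  set U := ∑ x, u x ^ 2 with hUdef
  set T := Real.sqrt D * (1 + ρ2 - δ' ^ 2) / 2 with hTdef
  have hT : 0 < T := by
    have : 0 < 1 + ρ2 - δ' ^ 2 := by linarith
    positivity
  -- the close sign vectors have a large correlation with `Re w`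
  have hsub : (Finset.univ.filter fun s : X → Bool => ∑ x, ‖signVec s x - w x‖ ^ 2 ≤ δ' ^ 2) ⊆
      Finset.univ.filter fun s : X → Bool => T ≤ ∑ x, sgn (s x) * u x := by
    intro s hs
    rw [Finset.mem_filter] at hs ⊢
    refine ⟨hs.1, ?_⟩
    have h := hs.2
    rw [sum_norm_sq_signVec_sub] at h
    rw [hTdef]
    have hsq : 0 < Real.sqrt D := Real.sqrt_pos.2 hD
    rw [div_le_iff₀ (by norm_num : (0 : ℝ) < 2)]
    have : 2 / Real.sqrt D * ∑ x, sgn (s x) * (w x).re = (2 * ∑ x, sgn (s x) * u x) / Real.sqrt D := by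
      rw [hu]; ring
    rw [this] at h
    have h' : 1 + ρ2 - δ' ^ 2 ≤ (2 * ∑ x, sgn (s x) * u x) / Real.sqrt D := by linarith
    rw [le_div_iff₀ hsq] at h'
    linarith
  have hUρ : U ≤ ρ2 := by
    refine Finset.sum_le_sum fun x _ => ?_
    rw [hu, Complex.sq_norm, Complex.normSq_apply]
    nlinarith [sq_nonneg (w x).im]
  by_cases hU0 : U = 0
  · -- then every `u x = 0` and no sign vector qualifies
    have hux : ∀ x, u x = 0 := by
      intro x
      have := (Finset.sum_eq_zero_iff_of_nonneg (fun x _ => sq_nonneg (u x))).1 (hUdef ▸ hU0) x (Finset.mem_univ x)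
      exact pow_eq_zero_iff (n := 2) (by norm_num) |>.1 this
    have hempty : (Finset.univ.filter fun s : X → Bool => T ≤ ∑ x, sgn (s x) * u x) = ∅ := by
      refine Finset.filter_false_of_mem fun s _ => ?_
      simp only [hux, mul_zero, Finset.sum_const_zero, not_le]
      exact hT
    have := Finset.card_le_card hsub
    rw [hempty, Finset.card_empty, Nat.le_zero] at this
    rw [this, Nat.cast_zero]
    positivity
  · have hUpos : 0 < U := lt_of_le_of_ne (Finset.sum_nonneg fun x _ => sq_nonneg (u x)) (Ne.symm hU0)
    have hρpos : 0 < ρ2 := lt_of_lt_of_le hUpos hUρ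
    calc ((Finset.univ.filter fun s : X → Bool => ∑ x, ‖signVec s x - w x‖ ^ 2 ≤ δ' ^ 2).card : ℝ)
        ≤ ((Finset.univ.filter fun s : X → Bool => T ≤ ∑ x, sgn (s x) * u x).card : ℝ) := by
          exact_mod_cast Finset.card_le_card hsub
      _ ≤ 2 ^ Fintype.card X * Real.exp (-(T ^ 2 / (2 * U))) := card_signs_sum_ge_le u hT.le hUpos
      _ ≤ 2 ^ Fintype.card X * Real.exp (-(D * (1 - δ' ^ 2) / 2)) := by
          refine mul_le_mul_of_nonneg_left (Real.exp_le_exp.2 (neg_le_neg ?_)) (by positivity)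
          -- `D (1 - δ'²)/2 ≤ T²/(2U)`
          have h1 : T ^ 2 / (2 * ρ2) ≤ T ^ 2 / (2 * U) :=
            div_le_div_of_nonneg_left (sq_nonneg T) (by positivity) (by linarith)
          refine le_trans ?_ h1
          rw [div_le_div_iff₀ (by norm_num : (0 : ℝ) < 2) (by positivity), hTdef, div_pow, mul_pow,
            Real.sq_sqrt hD.le]
          nlinarith [sq_nonneg (1 - δ' ^ 2 - ρ2), hD.le, hρ2nn]

end Signs

/-! ### A grid net on an orthonormal basis: few sign vectors near any low-dimensional span -/

section Net

variable {X : Type*} [Fintype X] [DecidableEq X]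

/-- Transport of a vector to `ℓ²(X)`. [folklore] -/
abbrev toE (v : X → ℂ) : EuclideanSpace ℂ X := WithLp.toLp 2 v

omit [DecidableEq X] in
/-- The `ℓ²` norm squared is the sum of squares. [folklore] -/
theorem norm_toE_sq (v : X → ℂ) : ‖toE v‖ ^ 2 = ∑ x, ‖v x‖ ^ 2 := by
  rw [EuclideanSpace.norm_sq_eq]

omit [DecidableEq X] in
/-- Sign vectors are unit vectors. [folklore] -/
theorem sum_norm_sq_signVec [Nonempty X] (s : X → Bool) : ∑ x, ‖signVec s x‖ ^ 2 = 1 := by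
  have := sum_norm_sq_signVec_sub s 0
  simpa using this

omit [DecidableEq X] in
/-- Sign vectors are unit vectors (in `ℓ²`). [folklore] -/
theorem norm_toE_signVec [Nonempty X] (s : X → Bool) : ‖toE (signVec s)‖ = 1 := by
  have h : ‖toE (signVec s)‖ ^ 2 = 1 := by rw [norm_toE_sq, sum_norm_sq_signVec]
  exact (pow_eq_one_iff_of_nonneg (norm_nonneg _) two_ne_zero).1 h

/-- Rounding a complex number to the grid `η ℤ[i]` moves it by less than `√2 η`. [folklore] -/
theorem norm_sub_round_sq_le (a : ℂ) {η : ℝ} (hη : 0 < η) :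
    ‖a - (((⌊a.re / η⌋ * η : ℝ) : ℂ) + ((⌊a.im / η⌋ * η : ℝ) : ℂ) * Complex.I)‖ ^ 2 ≤ 2 * η ^ 2 := by
  rw [Complex.sq_norm, Complex.normSq_apply]
  have h1 := Int.sub_floor_div_mul_nonneg a.re hη
  have h2 := Int.sub_floor_div_mul_lt a.re hη
  have h3 := Int.sub_floor_div_mul_nonneg a.im hη
  have h4 := Int.sub_floor_div_mul_lt a.im hη
  simp only [Complex.sub_re, Complex.sub_im, Complex.add_re, Complex.add_im, Complex.ofReal_re,
    Complex.ofReal_im, Complex.mul_re, Complex.mul_im, Complex.I_re, Complex.I_im, mul_zero, mul_one,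
    zero_add, add_zero, sub_zero]
  nlinarith

/-- Grid indices of a bounded coordinate lie in a box. [folklore] -/
theorem floor_div_mem_Icc {y η K : ℝ} (hy : |y| ≤ 2) (hη : 0 < η) (hK : 2 / η ≤ K) :
    ⌊y / η⌋ ∈ Finset.Icc (-((⌈K⌉₊ + 1 : ℕ) : ℤ)) ((⌈K⌉₊ + 1 : ℕ) : ℤ) := by
  rw [Finset.mem_Icc]
  have hyη : |y / η| ≤ K := by
    rw [abs_div, abs_of_pos hη]
    exact (div_le_div_of_nonneg_right hy hη.le).trans hK
  obtain ⟨hlo, hhi⟩ := abs_le.1 hyη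
  have hKc : K ≤ (⌈K⌉₊ : ℝ) := Nat.le_ceil K
  have hfl := Int.floor_le (y / η)
  have hlt := Int.lt_floor_add_one (y / η)
  constructor
  · have : (-((⌈K⌉₊ + 1 : ℕ) : ℤ) : ℝ) ≤ ⌊y / η⌋ := by push_cast; linarith
    exact_mod_cast this
  · have : (⌊y / η⌋ : ℝ) ≤ ((⌈K⌉₊ + 1 : ℕ) : ℤ) := by push_cast; linarith
    exact_mod_cast this

open Classical in
/-- **Few sign vectors lie near any span of `r` vectors.** For `0 ≤ δ`, `0 < ε`, `δ + ε < 1`: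
`#{s : dist(ε_s/√D, span(t₁,…,t_r)) ≤ δ} ≤ (2M+1)^{2r} · 2^D e^{−D(1−(δ+ε)²)/2}` with
`M = ⌈4r/ε⌉ + 1`: round the coordinates of the nearest point in an orthonormal basis of the span to
the grid of mesh `ε/(2r)`; sign vectors with the same rounding are within `δ + ε` of a common
centre (`card_signVec_close_le`). (Replaces the Haar-measure and Lévy-concentration step — Theorem
2.3, Lemma 2.4 and Lemma 3.4 — of Mehraban–Tahmasbi's proof of Lemma 3.2.) [folklore] -/
theorem card_signVec_close_span_le [Nonempty X] {r : ℕ} (hr : 0 < r) (t : Fin r → X → ℂ)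
    {δ ε : ℝ} (hδ : 0 ≤ δ) (hε : 0 < ε) (h1 : δ + ε < 1) :
    ((Finset.univ.filter fun s : X → Bool =>
        ∃ c : Fin r → ℂ, ∑ x, ‖signVec s x - (∑ i, c i • t i) x‖ ^ 2 ≤ δ ^ 2).card : ℝ) ≤
      ((2 * (⌈4 * r / ε⌉₊ + 1) + 1 : ℕ) : ℝ) ^ (2 * r) *
        (2 ^ Fintype.card X * Real.exp (-(Fintype.card X * (1 - (δ + ε) ^ 2) / 2))) := by
  classical
  -- the span and an orthonormal basis of it
  let V : Submodule ℂ (EuclideanSpace ℂ X) := Submodule.span ℂ (Set.range fun i => toE (t i))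
  let d : ℕ := Module.finrank ℂ V
  have hdr : d ≤ r := by
    have := finrank_range_le_card (R := ℂ) (fun i => toE (t i))
    simpa [Set.finrank] using this
  let b : OrthonormalBasis (Fin d) ℂ V := stdOrthonormalBasis ℂ V
  -- grid scale
  have hr' : (0 : ℝ) < r := Nat.cast_pos.2 hr
  let η : ℝ := ε / (2 * r)
  have hη0 : 0 < η := by positivity
  have hK : 2 / η = 4 * r / ε := by
    simp only [η]
    field_simp
    ring
  -- witnesses for the bad sign vectors
  let Bad := Finset.univ.filter fun s : X → Bool =>
      ∃ c : Fin r → ℂ, ∑ x, ‖signVec s x - (∑ i, c i • t i) x‖ ^ 2 ≤ δ ^ 2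
  let wit : (X → Bool) → Fin r → ℂ := fun s =>
    if h : ∃ c : Fin r → ℂ, ∑ x, ‖signVec s x - (∑ i, c i • t i) x‖ ^ 2 ≤ δ ^ 2 then Classical.choose h
    else 0
  let vs : (X → Bool) → X → ℂ := fun s => ∑ i, wit s i • t i
  have hwit : ∀ s ∈ Bad, ∑ x, ‖signVec s x - vs s x‖ ^ 2 ≤ δ ^ 2 := by
    intro s hs
    have h := (Finset.mem_filter.1 hs).2
    simp only [vs, wit, dif_pos h]
    exact Classical.choose_spec h
  have hmem : ∀ s, toE (vs s) ∈ V := by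
    intro s
    simp only [vs, WithLp.toLp_sum, WithLp.toLp_smul]
    exact Submodule.sum_mem _ fun i _ =>
      Submodule.smul_mem _ _ (Submodule.subset_span (Set.mem_range_self i))
  -- coordinates in the orthonormal basis
  let a : (X → Bool) → EuclideanSpace ℂ (Fin d) := fun s => b.repr ⟨toE (vs s), hmem s⟩
  have hdist : ∀ s ∈ Bad, ‖toE (signVec s) - toE (vs s)‖ ≤ δ := by
    intro s hs
    rw [← sq_le_sq₀ (norm_nonneg _) hδ, ← WithLp.toLp_sub, norm_toE_sq]
    simpa only [Pi.sub_apply] using hwit s hs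
  have hnorm_a : ∀ s ∈ Bad, ‖a s‖ ≤ 2 := by
    intro s hs
    have e1 : ‖a s‖ = ‖toE (vs s)‖ := by
      simp only [a, LinearIsometryEquiv.norm_map, Submodule.coe_norm]
    rw [e1]
    have h2 := norm_sub_norm_le (toE (vs s)) (toE (signVec s))
    rw [norm_sub_rev] at h2
    have h3 := hdist s hs
    have h4 := norm_toE_signVec s
    linarith
  have hcoord : ∀ s, (⟨toE (vs s), hmem s⟩ : V) = ∑ i, a s i • b i := fun s => (b.sum_repr _).symm
  have hcoordE : ∀ s, toE (vs s) = ∑ i, a s i • (b i : EuclideanSpace ℂ X) := by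
    intro s
    have := congrArg Subtype.val (hcoord s)
    simpa only [Submodule.coe_sum, Submodule.coe_smul] using this
  -- the rounding code and its box
  let code : (X → Bool) → Fin r → ℤ × ℤ := fun s i =>
    if h : (i : ℕ) < d then (⌊(a s ⟨i, h⟩).re / η⌋, ⌊(a s ⟨i, h⟩).im / η⌋) else (0, 0)
  let Box : Finset (Fin r → ℤ × ℤ) := Fintype.piFinset fun _ =>
    (Finset.Icc (-((⌈4 * r / ε⌉₊ + 1 : ℕ) : ℤ)) ((⌈4 * r / ε⌉₊ + 1 : ℕ) : ℤ)) ×ˢ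
      (Finset.Icc (-((⌈4 * r / ε⌉₊ + 1 : ℕ) : ℤ)) ((⌈4 * r / ε⌉₊ + 1 : ℕ) : ℤ))
  have hcardBox : Box.card = (2 * (⌈4 * r / ε⌉₊ + 1) + 1) ^ (2 * r) := by
    simp only [Box, Fintype.card_piFinset, Finset.prod_const, Finset.card_univ, Fintype.card_fin,
      Finset.card_product, Int.card_Icc]
    rw [pow_mul]
    congr 1
    have : (((⌈4 * r / ε⌉₊ + 1 : ℕ) : ℤ) + 1 - -((⌈4 * r / ε⌉₊ + 1 : ℕ) : ℤ)).toNat =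
        2 * (⌈4 * r / ε⌉₊ + 1) + 1 := by omega
    rw [this]
    ring
  have hmaps : ∀ s ∈ Bad, code s ∈ Box := by
    intro s hs
    rw [Fintype.mem_piFinset]
    intro i
    rw [Finset.mem_product]
    simp only [code]
    split_ifs with h
    · have hai : ‖a s ⟨i, h⟩‖ ≤ 2 := (PiLp.norm_apply_le (a s) ⟨i, h⟩).trans (hnorm_a s hs)
      exact ⟨floor_div_mem_Icc ((Complex.abs_re_le_norm _).trans hai) hη0 hK.le,
        floor_div_mem_Icc ((Complex.abs_im_le_norm _).trans hai) hη0 hK.le⟩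
    · simp only [Finset.mem_Icc]
      omega
  -- the bound for the close sign vectors around one centre
  have hδε : (δ + ε) ^ 2 < 1 := by
    have : 0 ≤ δ + ε := by linarith
    nlinarith
  -- fibres of the code are close to a common centre
  have hfiber : ∀ g ∈ Box, ((Bad.filter fun s => code s = g).card : ℝ) ≤
      2 ^ Fintype.card X * Real.exp (-(Fintype.card X * (1 - (δ + ε) ^ 2) / 2)) := by
    intro g _
    let gc : Fin d → ℂ := fun i =>
      (((g (Fin.castLE hdr i)).1 * η : ℝ) : ℂ) + (((g (Fin.castLE hdr i)).2 * η : ℝ) : ℂ) * Complex.I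
    let ctr : EuclideanSpace ℂ X := ∑ i, gc i • (b i : EuclideanSpace ℂ X)
    let w : X → ℂ := WithLp.ofLp ctr
    refine le_trans ?_ (card_signVec_close_le w hδε)
    refine Nat.cast_le.2 (Finset.card_le_card fun s hs => ?_)
    rw [Finset.mem_filter] at hs ⊢
    obtain ⟨hsBad, hsg⟩ := hs
    refine ⟨Finset.mem_univ _, ?_⟩
    -- `‖vs s - ctr‖ ≤ ε`
    have hround : ∀ i : Fin d, gc i =
        (((⌊(a s i).re / η⌋ * η : ℝ) : ℂ) + ((⌊(a s i).im / η⌋ * η : ℝ) : ℂ) * Complex.I) := by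
      intro i
      have hci : code s (Fin.castLE hdr i) = (⌊(a s i).re / η⌋, ⌊(a s i).im / η⌋) := by
        simp only [code, Fin.val_castLE, Fin.is_lt, dif_pos, Fin.eta]
      simp only [gc, ← hsg, hci]
    have hdiff : toE (vs s) - ctr = ∑ i, (a s i - gc i) • (b i : EuclideanSpace ℂ X) := by
      simp only [ctr, hcoordE, sub_smul, Finset.sum_sub_distrib]
    have hnear : ‖toE (vs s) - ctr‖ ≤ ε := by
      have hsum : ∑ i, (a s i - gc i) • (b i : EuclideanSpace ℂ X) =
          ((b.repr.symm (WithLp.toLp 2 fun i => a s i - gc i) : V) : EuclideanSpace ℂ X) := by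
        rw [← OrthonormalBasis.sum_repr_symm]
        simp only [Submodule.coe_sum, Submodule.coe_smul]
      have hn : ‖toE (vs s) - ctr‖ ^ 2 = ∑ i, ‖a s i - gc i‖ ^ 2 := by
        rw [hdiff, hsum, Submodule.norm_coe, LinearIsometryEquiv.norm_map, EuclideanSpace.norm_sq_eq]
      have hle : ‖toE (vs s) - ctr‖ ^ 2 ≤ ε ^ 2 := by
        rw [hn]
        calc ∑ i, ‖a s i - gc i‖ ^ 2 ≤ ∑ _i : Fin d, 2 * η ^ 2 :=
              Finset.sum_le_sum fun i _ => by rw [hround i]; exact norm_sub_round_sq_le _ hη0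
          _ = d * (2 * η ^ 2) := by rw [Finset.sum_const, Finset.card_univ, Fintype.card_fin, nsmul_eq_mul]
          _ ≤ r * (2 * η ^ 2) := by gcongr
          _ = ε ^ 2 / (2 * r) := by simp only [η]; field_simp
          _ ≤ ε ^ 2 := by
              refine div_le_self (sq_nonneg ε) ?_
              have : (1 : ℝ) ≤ r := Nat.one_le_cast.2 hr
              linarith
      exact (sq_le_sq₀ (norm_nonneg _) hε.le).1 hle
    -- hence `‖signVec s - w‖ ≤ δ + ε`
    have htot : ‖toE (signVec s) - toE w‖ ≤ δ + ε := by
      have hw : toE w = ctr := WithLp.toLp_ofLp 2 ctr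
      rw [hw]
      calc ‖toE (signVec s) - ctr‖ ≤ ‖toE (signVec s) - toE (vs s)‖ + ‖toE (vs s) - ctr‖ :=
            norm_sub_le_norm_sub_add_norm_sub _ _ _
        _ ≤ δ + ε := add_le_add (hdist s hsBad) hnear
    have := (sq_le_sq₀ (norm_nonneg _) (by linarith)).2 htot
    rw [← WithLp.toLp_sub, norm_toE_sq] at this
    simpa only [Pi.sub_apply] using this
  -- assemble
  calc (Bad.card : ℝ) = ∑ g ∈ Box, ((Bad.filter fun s => code s = g).card : ℝ) := by
        rw [Finset.card_eq_sum_card_fiberwise hmaps]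
        push_cast
        rfl
    _ ≤ ∑ _g ∈ Box, 2 ^ Fintype.card X * Real.exp (-(Fintype.card X * (1 - (δ + ε) ^ 2) / 2)) :=
        Finset.sum_le_sum hfiber
    _ = ((2 * (⌈4 * r / ε⌉₊ + 1) + 1 : ℕ) : ℝ) ^ (2 * r) *
          (2 ^ Fintype.card X * Real.exp (-(Fintype.card X * (1 - (δ + ε) ^ 2) / 2))) := by
        rw [Finset.sum_const, nsmul_eq_mul, hcardBox]
        push_cast
        ring

end Net

/-! ### Assembly -/

section Assembly

/-- `|QReg n| = 2ⁿ`. [folklore] -/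
theorem card_QReg (n : ℕ) : Fintype.card (QReg n) = 2 ^ n := by
  simp [QReg]

/-- A stabilizer decomposition can be padded with zero terms to any larger length. [folklore] -/
theorem exists_decomp_of_stabilizerRank_le {ψ : QReg n → ℂ} {r : ℕ} (h : stabilizerRank ψ ≤ r) :
    ∃ (c : Fin r → ℂ) (φ : Fin r → QReg n → ℂ), (∀ i, φ i ∈ stabilizerStates n) ∧ ψ = ∑ i, c i • φ i := by
  obtain ⟨k, rfl⟩ : ∃ k, r = stabilizerRank ψ + k := ⟨r - stabilizerRank ψ, by omega⟩
  clear h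
  induction k with
  | zero => simpa using exists_stabilizerDecomposition ψ
  | succ k ih =>
    obtain ⟨c, φ, hφ, hψ⟩ := ih
    refine ⟨Fin.snoc c 0, Fin.snoc φ (zeroState n), fun i => ?_, ?_⟩
    · refine Fin.lastCases ?_ (fun j => ?_) i
      · simpa using zeroState_mem_stabilizerStates n
      · simpa using hφ j
    · show ψ = ∑ i : Fin (stabilizerRank ψ + k + 1),
        Fin.snoc (α := fun _ => ℂ) c 0 i • Fin.snoc (α := fun _ => QReg n → ℂ) φ (zeroState n) i
      rw [Fin.sum_univ_castSucc]
      simp [hψ]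

/-- Vectors of stabilizer rank `≤ r` lie in the span of `r` parameter vectors. [folklore] -/
theorem exists_param_comb_of_stabilizerRank_le {ψ : QReg n → ℂ} {r : ℕ} (h : stabilizerRank ψ ≤ r) :
    ∃ (P : Fin r → Param n) (c : Fin r → ℂ), ψ = ∑ i, c i • vec (P i) := by
  obtain ⟨c, φ, hφ, rfl⟩ := exists_decomp_of_stabilizerRank_le h
  choose P c' hPc using fun i => exists_param_of_mem_stabilizerStates (hφ i)
  refine ⟨P, fun i => c i * c' i, Finset.sum_congr rfl fun i _ => ?_⟩
  rw [hPc i, smul_smul]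

/-- Definitional unfolding of the tree's `normSq`. [folklore] -/
theorem normSq_eq_sum_norm_sq (ψ : QReg n → ℂ) : normSq ψ = ∑ x, ‖ψ x‖ ^ 2 := rfl

/-- `b^k = exp(k log b)` for `b > 0`. [folklore] -/
theorem pow_eq_exp_mul_log {b : ℝ} (hb : 0 < b) (k : ℕ) : b ^ k = Real.exp (k * Real.log b) := by
  rw [Real.exp_nat_mul, Real.exp_log hb]

/-- `log 2 ≤ 1`. [folklore] -/
theorem log_two_le_one : Real.log 2 ≤ 1 := by
  have := Real.log_two_lt_d9
  linarith

/-- **The analytic inequality** behind the union bound: with `g = 1 − δ²`, `C = 1/1000`,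
`1 ≤ r ≤ C g² 2ⁿ/n²`, `n ≥ 2 log₂(1/g) + 9`:
`r (3n² + 3n) log 2 + 2 r log(2⌈16 r/g⌉ + 3) − 2ⁿ (1 − (δ + g/4)²)/2 < 0`. [folklore] -/
theorem key_inequality {δ : ℝ} (hδ0 : 0 < δ) (hδ1 : δ < 1) {n : ℕ}
    (hn : 2 * Real.logb 2 (1 / (1 - δ ^ 2)) + 9 ≤ n) {r : ℕ} (hr1 : 1 ≤ r)
    (hrR : (r : ℝ) ≤ 1 / 1000 * (1 - δ ^ 2) ^ 2 * 2 ^ n / (n : ℝ) ^ 2) :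
    (r : ℝ) * ((3 * n ^ 2 + 3 * n : ℕ) * Real.log 2) +
        2 * r * Real.log ((2 * (⌈4 * r / ((1 - δ ^ 2) / 4)⌉₊ + 1) + 1 : ℕ) : ℝ) -
      (2 ^ n : ℝ) * (1 - (δ + (1 - δ ^ 2) / 4) ^ 2) / 2 < 0 := by
  set g := 1 - δ ^ 2 with hg
  have hg0 : 0 < g := by nlinarith
  have hg1 : g ≤ 1 := by nlinarith
  have hr' : (1 : ℝ) ≤ r := Nat.one_le_cast.2 hr1
  have hlogb : 0 ≤ Real.logb 2 (1 / g) :=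
    Real.logb_nonneg one_lt_two (by rw [le_div_iff₀ hg0]; linarith)
  have hn9 : (9 : ℝ) ≤ n := by linarith
  have hn0 : (0 : ℝ) < n := by linarith
  -- `log (1/g) ≤ (n - 9)/2`
  have hlog_g : Real.log (1 / g) ≤ (n - 9) / 2 := by
    have h2 : 0 < Real.log 2 := Real.log_pos one_lt_two
    have : Real.log (1 / g) = Real.logb 2 (1 / g) * Real.log 2 := by
      rw [Real.logb, div_mul_cancel₀ _ h2.ne']
    rw [this]
    calc Real.logb 2 (1 / g) * Real.log 2 ≤ Real.logb 2 (1 / g) * 1 :=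
          mul_le_mul_of_nonneg_left log_two_le_one hlogb
      _ ≤ (n - 9) / 2 := by linarith
  -- `r ≤ 2ⁿ`, so `log r ≤ n`
  have hD1 : (1 : ℝ) ≤ 2 ^ n := one_le_pow₀ (by norm_num)
  have hrD : (r : ℝ) ≤ 2 ^ n := by
    refine hrR.trans ?_
    rw [div_le_iff₀ (by positivity)]
    have : (1 : ℝ) ≤ (n : ℝ) ^ 2 := by nlinarith
    nlinarith [pow_le_one₀ hg0.le hg1 (n := 2)]
  have hlog_r : Real.log r ≤ n := by
    calc Real.log r ≤ Real.log (2 ^ n) := Real.log_le_log (by linarith) hrD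
      _ = n * Real.log 2 := by rw [Real.log_pow]
      _ ≤ n * 1 := mul_le_mul_of_nonneg_left log_two_le_one hn0.le
      _ = n := mul_one _
  -- the box size: `2⌈16 r/g⌉ + 3 ≤ 37 r / g`
  have hceil : ((2 * (⌈4 * r / (g / 4)⌉₊ + 1) + 1 : ℕ) : ℝ) ≤ 37 * r / g := by
    have hy : (0 : ℝ) ≤ 4 * r / (g / 4) := by positivity
    have hc := Nat.ceil_lt_add_one hy
    have e : (4 : ℝ) * r / (g / 4) = 16 * (r / g) := by
      field_simp
      ring
    have hrg : (1 : ℝ) ≤ r / g := by rw [le_div_iff₀ hg0]; linarith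
    have e2 : (37 : ℝ) * r / g = 37 * (r / g) := by ring
    rw [e2]
    push_cast
    linarith
  have hlog_box : Real.log ((2 * (⌈4 * r / (g / 4)⌉₊ + 1) + 1 : ℕ) : ℝ) ≤ 6 + n + (n - 9) / 2 := by
    have hpos : (0 : ℝ) < ((2 * (⌈4 * r / (g / 4)⌉₊ + 1) + 1 : ℕ) : ℝ) := by positivity
    calc Real.log ((2 * (⌈4 * r / (g / 4)⌉₊ + 1) + 1 : ℕ) : ℝ) ≤ Real.log (37 * r / g) :=
          Real.log_le_log hpos hceil
      _ = Real.log 37 + Real.log r + Real.log (1 / g) := by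
          rw [show (37 : ℝ) * r / g = 37 * r * (1 / g) by ring, Real.log_mul (by positivity) (by positivity),
            Real.log_mul (by norm_num) (by positivity)]
      _ ≤ 6 + n + (n - 9) / 2 := by
          have h37 : Real.log 37 ≤ 6 := by
            calc Real.log 37 ≤ Real.log (2 ^ 6) := Real.log_le_log (by norm_num) (by norm_num)
              _ = 6 * Real.log 2 := by rw [Real.log_pow]; norm_num
              _ ≤ 6 * 1 := by gcongr; exact log_two_le_one
              _ = 6 := by norm_num
          linarith
  -- the gap: `1 - (δ + g/4)² ≥ g/4`
  have hgap : g / 4 ≤ 1 - (δ + g / 4) ^ 2 := by nlinarith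
  -- combine
  have h3 : (r : ℝ) * ((3 * n ^ 2 + 3 * n : ℕ) * Real.log 2) ≤ r * (3 * n ^ 2 + 3 * n) := by
    refine mul_le_mul_of_nonneg_left ?_ (by positivity)
    push_cast
    calc ((3 : ℝ) * n ^ 2 + 3 * n) * Real.log 2 ≤ (3 * n ^ 2 + 3 * n) * 1 :=
          mul_le_mul_of_nonneg_left log_two_le_one (by positivity)
      _ = 3 * n ^ 2 + 3 * n := mul_one _
  have h4 : 2 * (r : ℝ) * Real.log ((2 * (⌈4 * r / (g / 4)⌉₊ + 1) + 1 : ℕ) : ℝ) ≤ 2 * r * (6 + n + (n - 9) / 2) :=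
    mul_le_mul_of_nonneg_left hlog_box (by positivity)
  have h5 : (r : ℝ) * (3 * n ^ 2 + 3 * n) + 2 * r * (6 + n + (n - 9) / 2) ≤ 4 * n ^ 2 * r := by
    have : (3 : ℝ) * n ^ 2 + 3 * n + 2 * (6 + n + (n - 9) / 2) ≤ 4 * n ^ 2 := by nlinarith
    nlinarith
  have h6 : (4 : ℝ) * n ^ 2 * r ≤ 4 / 1000 * g ^ 2 * 2 ^ n := by
    have := mul_le_mul_of_nonneg_left hrR (by positivity : (0 : ℝ) ≤ 4 * n ^ 2)
    refine this.trans (le_of_eq ?_)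
    field_simp
  have h7 : (2 ^ n : ℝ) * (g / 4) / 2 ≤ (2 ^ n : ℝ) * (1 - (δ + g / 4) ^ 2) / 2 := by gcongr
  have h8 : 4 / 1000 * g ^ 2 * (2 : ℝ) ^ n < (2 ^ n : ℝ) * (g / 4) / 2 := by
    have : 4 / 1000 * g ^ 2 < g / 8 := by nlinarith
    nlinarith
  linarith

end Assembly

end ApproxRankTypical

open ApproxRankTypical in
/-- **Discharge of `MehrabanTahmasbi2024_exists_large_approxRank`** (Mehraban–Tahmasbi 2024,
Lemma 3.2: for `0 < δ < 1` and `n ≥ 2 log₂(1/(1−δ²)) + 9` some unit `n`-qubit state has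
`χ_δ ≥ (1/1000)(1−δ²)² 2ⁿ/n²`).

Proof (probabilistic method over the `2^{2ⁿ}` *sign states* `φ_s = 2^{-n/2} Σ_x (−1)^{s(x)} |x⟩`
instead of the Haar measure of the printed proof; the architecture — count the low-rank directions,
bound the mass of states near one span, union bound — is that of the printed proof of Lemma 3.2,
§3.1, which uses Lemma 3.4, the count Lemma 2.2 and Lévy concentration, Theorem 2.3/Lemma 2.4):
1. (*counting stabilizer states*, replacing `|Stab_n| ≤ 2^{0.54 n²}` from Aaronson–Gottesman) every
   stabilizer state is a multiple of one of `2^{3n²+3n}` vectors `vec P` — the Dehaene–De Moor normal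
   form `[x ∈ a + span v] i^{ℓ(x) + 2q(x)}`, proved here by closure under `H, S, CNOT`
   (`exists_param_of_mem_stabilizerStates`); hence every vector of rank `≤ r` lies in one of
   `2^{(3n²+3n) r}` spans of `r` vectors (`exists_param_comb_of_stabilizerRank_le`, the rank being
   attained, `exists_stabilizerDecomposition`);
2. (*mass near one span*) by Hoeffding's exponential-moment
   bound at most `2^{2ⁿ} e^{−2ⁿ(1−δ'²)/2}` sign states are within `δ'` of any fixed vector
   (`card_signVec_close_le`, replacing Lévy concentration, Theorem 2.3 with Lemma 2.4), and rounding
   coordinates in an orthonormal basis of the span to a grid at most `(2⌈16r/(1−δ²)⌉+3)^{2r}`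
   centres are needed with `δ' = δ + (1−δ²)/4` (`card_signVec_close_span_le`);
3. (*union bound*) with `r = ⌈(1/1000)(1−δ²)² 2ⁿ/n²⌉ − 1` the total is `< 2^{2ⁿ}`
   (`key_inequality`), so some sign state is `δ`-far from every vector of stabilizer rank `≤ r`, i.e.
   has `χ_δ ≥ r + 1 ≥ (1/1000)(1−δ²)² 2ⁿ/n²`.
[cite: MehrabanTahmasbi2024, Lemma 3.2 (arXiv:2305.10277 §3.1 pp. 12–13, with Lemma 3.4, Lemma 2.2, Thm. 2.3)] -/
theorem MehrabanTahmasbi2024_exists_large_approxRank_holds : MehrabanTahmasbi2024_exists_large_approxRank := by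
  classical
  refine ⟨1 / 1000, le_rfl, fun δ hδ0 hδ1 n hn => ?_⟩
  set g := 1 - δ ^ 2 with hg
  have hg0 : 0 < g := by nlinarith
  have hg1 : g ≤ 1 := by nlinarith
  set R₀ : ℝ := 1 / 1000 * g ^ 2 * 2 ^ n / (n : ℝ) ^ 2 with hR₀
  have hR₀0 : 0 ≤ R₀ := by positivity
  set r : ℕ := ⌈R₀⌉₊ - 1 with hr
  have hrR : (r : ℝ) ≤ R₀ := by
    have := Nat.ceil_lt_add_one hR₀0
    rw [hr]
    rcases Nat.eq_zero_or_pos ⌈R₀⌉₊ with h0 | hpos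
    · rw [h0]; simpa using hR₀0
    · rw [Nat.cast_sub hpos, Nat.cast_one]; linarith
  -- Main claim: some sign state is `δ`-far from all vectors of stabilizer rank `≤ r`.
  suffices hmain : ∃ s : QReg n → Bool, ∀ φ' : QReg n → ℂ,
      normSq (signVec s - φ') ≤ δ ^ 2 → ¬ stabilizerRank φ' ≤ r by
    obtain ⟨s, hs⟩ := hmain
    refine ⟨signVec s, sum_norm_sq_signVec s, ?_⟩
    have hne : {k | ∃ φ : QReg n → ℂ, normSq (signVec s - φ) ≤ δ ^ 2 ∧ stabilizerRank φ = k}.Nonempty :=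
      ⟨_, signVec s, by simp [normSq_eq_sum_norm_sq, sq_nonneg], rfl⟩
    obtain ⟨φ', hφ'1, hφ'2⟩ := Nat.sInf_mem hne
    have hge : r + 1 ≤ approxStabilizerRank δ (signVec s) := by
      show r + 1 ≤ sInf {k | ∃ φ : QReg n → ℂ, normSq (signVec s - φ) ≤ δ ^ 2 ∧ stabilizerRank φ = k}
      rw [← hφ'2]
      exact Nat.lt_of_not_le (hs φ' hφ'1)
    calc 1 / 1000 * (1 - δ ^ 2) ^ 2 * (2 : ℝ) ^ n / (n : ℝ) ^ 2 = R₀ := by rw [hR₀]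
      _ ≤ ⌈R₀⌉₊ := Nat.le_ceil _
      _ ≤ (r + 1 : ℕ) := by rw [hr]; exact_mod_cast (by omega : ⌈R₀⌉₊ ≤ ⌈R₀⌉₊ - 1 + 1)
      _ ≤ approxStabilizerRank δ (signVec s) := by exact_mod_cast hge
  by_contra hall
  push Not at hall
  -- `hall : ∀ s, ∃ φ', normSq (signVec s - φ') ≤ δ ^ 2 ∧ stabilizerRank φ' ≤ r`
  rcases Nat.eq_zero_or_pos r with hr0 | hr1
  · -- rank `0` means `φ' = 0`, which is at distance `1 > δ` from a unit vector
    obtain ⟨φ', h1, h2⟩ := hall fun _ => false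
    rw [hr0, Nat.le_zero] at h2
    obtain ⟨c, φ, _, hφ'⟩ := exists_decomp_of_stabilizerRank_le h2.le
    rw [Finset.univ_eq_empty, Finset.sum_empty] at hφ'
    rw [hφ', sub_zero, normSq_eq_sum_norm_sq, sum_norm_sq_signVec] at h1
    nlinarith
  · -- the union bound
    set ε := g / 4 with hε
    have hε0 : 0 < ε := by positivity
    have hδε : δ + ε < 1 := by nlinarith
    -- every sign state is close to the span of some `r`-tuple of parameter vectors
    let BadP : (Fin r → Param n) → Finset (QReg n → Bool) := fun P =>
      Finset.univ.filter fun s => ∃ c : Fin r → ℂ, ∑ x, ‖signVec s x - (∑ i, c i • vec (P i)) x‖ ^ 2 ≤ δ ^ 2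
    have hcover : (Finset.univ : Finset (QReg n → Bool)) ⊆ Finset.univ.biUnion BadP := by
      intro s _
      obtain ⟨φ', h1, h2⟩ := hall s
      obtain ⟨P, c, hφ'⟩ := exists_param_comb_of_stabilizerRank_le h2
      rw [Finset.mem_biUnion]
      refine ⟨P, Finset.mem_univ _, Finset.mem_filter.2 ⟨Finset.mem_univ _, c, ?_⟩⟩
      rw [← hφ']
      simpa only [normSq_eq_sum_norm_sq, Pi.sub_apply] using h1
    have hbound : ∀ P : Fin r → Param n, ((BadP P).card : ℝ) ≤
        ((2 * (⌈4 * r / ε⌉₊ + 1) + 1 : ℕ) : ℝ) ^ (2 * r) *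
          (2 ^ Fintype.card (QReg n) * Real.exp (-(Fintype.card (QReg n) * (1 - (δ + ε) ^ 2) / 2))) :=
      fun P => card_signVec_close_span_le hr1 (fun i => vec (P i)) hδ0.le hε0 hδε
    have hcount : ((2 : ℝ) ^ (2 ^ n)) ≤ (2 ^ (3 * n ^ 2 + 3 * n) : ℝ) ^ r *
        (((2 * (⌈4 * r / ε⌉₊ + 1) + 1 : ℕ) : ℝ) ^ (2 * r) *
          (2 ^ (2 ^ n) * Real.exp (-((2 ^ n : ℝ) * (1 - (δ + ε) ^ 2) / 2)))) := by
      have h1 : (Fintype.card (QReg n → Bool) : ℝ) ≤ ∑ P : Fin r → Param n, ((BadP P).card : ℝ) := by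
        have := (Finset.card_le_card hcover).trans Finset.card_biUnion_le
        rw [Finset.card_univ] at this
        exact_mod_cast this
      rw [Fintype.card_fun, Fintype.card_bool, card_QReg] at h1
      push_cast at h1
      refine h1.trans ?_
      have h2 := Finset.sum_le_sum fun P (_ : P ∈ (Finset.univ : Finset (Fin r → Param n))) => hbound P
      refine h2.trans (le_of_eq ?_)
      rw [Finset.sum_const, Finset.card_univ, Fintype.card_fun, Fintype.card_fin, card_param, nsmul_eq_mul,
        card_QReg]
      push_cast
      ring
    -- but the right-hand side is `< 2^(2^n)`
    have hkey := key_inequality hδ0 hδ1 hn hr1 hrR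
    have hlt : (2 ^ (3 * n ^ 2 + 3 * n) : ℝ) ^ r *
        (((2 * (⌈4 * r / ε⌉₊ + 1) + 1 : ℕ) : ℝ) ^ (2 * r) *
          (2 ^ (2 ^ n) * Real.exp (-((2 ^ n : ℝ) * (1 - (δ + ε) ^ 2) / 2)))) < (2 : ℝ) ^ (2 ^ n) := by
      have hb : (0 : ℝ) < ((2 * (⌈4 * r / ε⌉₊ + 1) + 1 : ℕ) : ℝ) := by positivity
      rw [show (2 ^ (3 * n ^ 2 + 3 * n) : ℝ) ^ r = Real.exp (r * ((3 * n ^ 2 + 3 * n : ℕ) * Real.log 2)) by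
          rw [← pow_mul, pow_eq_exp_mul_log two_pos]; push_cast; ring_nf,
        show (((2 * (⌈4 * r / ε⌉₊ + 1) + 1 : ℕ) : ℝ)) ^ (2 * r) =
            Real.exp (2 * r * Real.log ((2 * (⌈4 * r / ε⌉₊ + 1) + 1 : ℕ) : ℝ)) by
          rw [pow_eq_exp_mul_log hb]; push_cast; ring_nf]
      have : Real.exp (r * ((3 * n ^ 2 + 3 * n : ℕ) * Real.log 2)) *
          (Real.exp (2 * r * Real.log ((2 * (⌈4 * r / ε⌉₊ + 1) + 1 : ℕ) : ℝ)) *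
            (2 ^ (2 ^ n) * Real.exp (-((2 ^ n : ℝ) * (1 - (δ + ε) ^ 2) / 2)))) =
          2 ^ (2 ^ n) * Real.exp (r * ((3 * n ^ 2 + 3 * n : ℕ) * Real.log 2) +
            2 * r * Real.log ((2 * (⌈4 * r / ε⌉₊ + 1) + 1 : ℕ) : ℝ) -
              (2 ^ n : ℝ) * (1 - (δ + ε) ^ 2) / 2) := by
        rw [Real.exp_sub, Real.exp_add, Real.exp_neg]
        ring
      rw [this]
      have hexp : Real.exp (r * ((3 * n ^ 2 + 3 * n : ℕ) * Real.log 2) +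
            2 * r * Real.log ((2 * (⌈4 * r / ε⌉₊ + 1) + 1 : ℕ) : ℝ) -
              (2 ^ n : ℝ) * (1 - (δ + ε) ^ 2) / 2) < 1 :=
        Real.exp_lt_one_iff.2 hkey
      have h2pos : (0 : ℝ) < 2 ^ (2 ^ n) := by positivity
      nlinarith
    exact absurd (hcount.trans_lt hlt) (lt_irrefl _)

end Literature.Computability.QuantumComplexity
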